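import Literature.NumberTheory.Sieve.HeathBrownCubicApproxUB
import Mathlib.Order.Fin.Tuple
import HarnessLib

/-!
# Heath-Brown's Lemma 3.7 from Lemma 7.1, IX: the generic `U₂^{(1)}`-approximation inequality

Pure-proof file (no definitions) in the deduction of **Lemma 3.7 from the corrected Lemma 7.1** of
D. R. Heath-Brown, *Primes represented by `x³ + 2y³`*, Acta Math. 186 (2001), 1–84, §7 pp. 42–47
(decomposition of **parity.S18**, `Literature.NumberTheory.Sieve.setOf_prime_cube_add_two_mul_cube_infinite`).
Of the ten bounds of Lemma 3.7 (`HeathBrown2001_lemma_3_7`, `HeathBrownCubicTypeII`) the eight for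
`S₄`, `U^(n)` (`n ≥ 3`), `U₁^(1)`, `U₁^(2)` are derived from Lemma 7.1 in `HeathBrownCubicApproxS4`,
`HeathBrownCubicApproxUA`, `HeathBrownCubicApproxUB`. This file and its sequel treat the remaining
piece **`U₂^{(1)}`** (p. 13: the part of `U^(1)` with `N(P₁P₂) ≥ X^{3/2+τ}`; `U2one` of
`HeathBrownCubicSieveDecomposition`) and its approximation **`Û₂^{(1)}`** (pp. 16–17; `U2hat` of
`HeathBrownCubicTypeII`): "In the case of `U₂^{(1)}(𝒜)` the rôles of `R` and `S` are reversed. We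
confine `N(P₁)` and `N(P₂)` to intervals `J(n₁)` and `J(n₂)` … and we replace `S_K(𝒜_{P₁P₂}, N(P₂))`
by `S_K^{(1)}(𝒜_{P₁P₂}, X^{n₂ξ})`. This counts products `P₁P₂Q₁⋯Q_{n+1}` … we may approximate
`U₂^{(1)}(𝒜)` satisfactorily by `∑_{n,𝐦} Û^{(𝐦,n)}(𝒜)`" (p. 16), the errors being estimated in §7,
pp. 46–47: "Here too we follow the same argument as used for `U^(n)` … Note that, in applying
Lemma 7.1, we have `N(P₁P₂) ≤ X^{2−2τ}`. Then, when we introduce the ideals `Q₁, …, Q_{n+1}` all the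
errors in the subsequent manoeuvres can still be estimated via Lemma 7.1, in view of the bound
`#{P₂ : P₁P₂ ∈ 𝒜_{Q₁⋯Q_{n+1}}} ≤ S_K(𝒜_{Q₁⋯Q_{n+1}}, X^τ)`."

Here the comparison is carried out for a general finite family of nonzero ideals with
`X³ < N(I_i) ≤ C_N X³`, before any use of Lemma 7.1 (`U2_abs_sub_le`); the sequel
(`HeathBrownCubicApproxU2`) feeds the resulting sums of sifting functions into the corrected Lemma 7.1
for `𝒜^(K)` and `ℬ^(K)`.

## The argument

* Hat side (`U2hat_eq_sum`): `Û₂^{(1)} = ∑_b G(b)` over the hat indices `b = ((n₁,n₂), P₁, P₂)`,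
  `(n₁,n₂) ∈ nPairs`, `P_j ∈ 𝒥(n_j)`, where `G(b) = ∑_{(n,𝐦,(Q_j))} wt · #{i : P₁P₂Q₁⋯Q_{n+1} = I_i}`
  runs over the vectors `𝐦` of `Û₂^{(1)}` (`m_{n+1} ≥ n₂`) and tuples `Q_j ∈ 𝒥(m_j)` with the weight
  `wt = ∏ log N(Q_j)/(m_jξ log X) ∈ [1, (1+μ^{-1})^{N+1}]` (the pair `(P₁, P₂)` with given product is
  unique, `sum_divisorPairs_c2Coef_eq`; the tuple behind a member is unique, `U2_tuple_unique`).
* Exact side: `U₂^{(1)} = ∑_t S_K^≺(𝒵_{P₁P₂}, P₂)` over `t = ({P₁}, P₂)`; the hat indices embed by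
  `φ(b) = ({P₁}, P₂)` (`U2_index_props`), and the unmatched good `t` lie in four edge/close classes
  (`U2_unmatched_cases`: a norm `< X^{τ+ξ}` or `≥ X^{1−τ−ξ}`, the two norms within a factor `X^ξ`,
  or `N(P₁P₂) < C_N X^{3/2+τ+2ξ}`).
* At a matched index (`U2_per_index_le`) the exactly counted members `Ex` and the hat-counted
  members `Ht` are compared directly: `Ht ∖ Ex` consists of members with a prime factor `Q_j ≺ P₂`
  in the box of `P₂` — a close pair or an equal-norm pair of prime factors
  (`U2_close_or_eq_of_primeLT`, the Buchstab range of p. 44); `Ex ∖ Ht`, away from the product window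
  `N(P₁P₂) < C_N X^{3/2+τ+2ξ}`, consists of members whose cofactor is NOT a hat tuple, which forces
  one of four defects — a close pair, an equal-norm pair, a prime factor of degree `≥ 2`, a square
  factor (`U2_exists_tuple`: the cofactor has at most two prime factors, each `≥ N(P₂) ≥ X^{1/2+2τ}`,
  and without defects they lie in boxes `𝒥(m₁) ∋ Q₁`, `𝒥(m₂) ∋ Q₂`, `m₁ > m₂ ≥ n₂`, with (3.6), (3.7)
  automatic from `X^{1+2τ} < N(Q₁Q₂) ≤ X^{3/2−τ−2ξ}`); the weight contributes
  `((1+μ^{-1})^{N+1} − 1) S_K(𝒵_{P₁P₂}, X^τ)`.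
* The defective members are counted through the OTHER factor (p. 47): an `X^{1/2}`-rough member of
  norm `≤ C_N X³` has at most `6` prime factors, hence is divisible by `P₁P₂` for at most `36` hat
  indices (`U2_sum_card_le_mul`), and the members with a defect are at most the sums of
  `S_K(𝒵_{QP}, X^{1/2})` over close pairs, `#𝒵_{QQ'}` over equal-norm pairs, `#𝒵_Q` over primes of
  degree `≥ 2`, `#𝒵_{Q²}` over first-degree `Q` (`card_feat_le`).

## References

* D. R. Heath-Brown, *Primes represented by `x³ + 2y³`*, Acta Math. 186 (2001), 1–84: §3 pp. 13,
  16–17 (`U₂^{(1)}`, `Û₂^{(1)}`), §7 pp. 42–47. [cite: HeathBrownActa2001, §7 pp. 46–47]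
* G. Harman, *Prime-Detecting Sieves*, LMS Monographs 33, Princeton (2007), §13.2. [cite: Harman2007, §13.2]

## Mathlib / tree search

Mathlib: `Finset.sum_sigma`, `Finset.sum_comm`, `Finset.card_le_card_of_injOn`,
`Finset.card_biUnion_le`, `Finset.card_inter_add_card_sdiff`, `StrictAnti.vecCons`,
`strictAnti_vecEmpty`, `Fin.prod_univ_two`, `Ideal.exists_le_maximal`, `mul_left_cancel₀` on ideals
(no sieve-theoretic counterpart; searched `Buchstab`, `bilinear`). Tree: `HeathBrownCubicHatCore`
(`bilin_dWeight_eq_sum_tuples`, `tuple_eq_of_prod_eq`, `tupleWt_bounds`, `exists_mem_Jprimes`,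
`Jprimes_index_unique`, `isRough_mul_iff`), `HeathBrownCubicApproxUCore` (`isRough_prod_of_le`),
`HeathBrownCubicApproxUE3` (`card_primeFactorsFinset_le_six`), `HeathBrownCubicUpperBoundTools`
(`famCount`, `uIdeal`, `UGood`, `mem_Upairs_iff`, `mem_chains_iff`, `mem_smallPrimes_iff`,
`UpieceWhere_eq`, `famSiftedAbove_le_famSifted`), `HeathBrownCubicTypeII` (`U2hat`, `nPairs`,
`mIndexU2`, `c2Coef`, `mem_mIndexU2_iff`, `mem_nPairs`, `CoreAdmissible`),
`HeathBrownCubicSieveDecomposition` (`U2one`, `Upairs`, `PrimeLT`).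
-/

noncomputable section

open Polynomial NumberField Finset Filter Topology Asymptotics
open scoped nonZeroDivisors

namespace Literature.NumberTheory.Sieve.CubicSieve

open LFunctions.CubeRootTwoField CubicPrimes
open Literature.NumberTheory.LFunctions (idealNormCount)

section Elementary

/-- `|#s − #t| ≤ #(s ∖ t) + #(t ∖ s)` for finite sets. [folklore] -/
theorem abs_card_sub_card_le {α : Type*} [DecidableEq α] (s t : Finset α) :
    |((#s : ℕ) : ℝ) - (#t : ℕ)| ≤ (#(s \ t) : ℕ) + (#(t \ s) : ℕ) := by
  have h1 : #(s ∩ t) + #(s \ t) = #s := card_inter_add_card_sdiff s t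
  have h2 : #(t ∩ s) + #(t \ s) = #t := card_inter_add_card_sdiff t s
  have h3 : #(s ∩ t) = #(t ∩ s) := by rw [inter_comm]
  have e1 : ((#s : ℕ) : ℝ) = #(s ∩ t) + #(s \ t) := by exact_mod_cast h1.symm
  have e2 : ((#t : ℕ) : ℝ) = #(t ∩ s) + #(t \ s) := by exact_mod_cast h2.symm
  have e3 : ((#(s ∩ t) : ℕ) : ℝ) = #(t ∩ s) := by exact_mod_cast h3
  have h4 : (0 : ℝ) ≤ #(s \ t) := Nat.cast_nonneg _
  have h5 : (0 : ℝ) ≤ #(t \ s) := Nat.cast_nonneg _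
  rw [abs_sub_le_iff]
  constructor <;> linarith

/-- The prime ideal factors of a product of nonzero prime ideals `Q_j` are the `Q_j`. [folklore] -/
theorem primeFactorsFinset_prod_eq_image {k : ℕ} {Q : Fin k → Ideal (𝓞 K)}
    (hQ : ∀ j, (Q j).IsPrime ∧ Q j ≠ ⊥) :
    primeFactorsFinset (∏ j, Q j) = (univ : Finset (Fin k)).image Q := by
  classical
  have h0 : (∏ j, Q j) ≠ ⊥ := by
    refine Finset.prod_ne_zero_iff.mpr fun j _ => ?_
    rw [Ne, Ideal.zero_eq_bot]
    exact (hQ j).2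
  ext P
  rw [mem_primeFactorsFinset_iff h0, mem_image]
  constructor
  · rintro ⟨hP, hPd⟩
    have hP0 : P ≠ ⊥ := by
      rintro rfl
      have h1 : (0 : Ideal (𝓞 K)) ∣ ∏ j, Q j := by rwa [Ideal.zero_eq_bot]
      have h2 := zero_dvd_iff.mp h1
      exact h0 (by rwa [Ideal.zero_eq_bot] at h2)
    obtain ⟨j, -, hj⟩ := (Ideal.prime_of_isPrime hP0 hP).exists_mem_finset_dvd hPd
    refine ⟨j, mem_univ _, ?_⟩
    exact ((hQ j).1.isMaximal (hQ j).2).eq_of_le hP.ne_top (Ideal.le_of_dvd hj)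
  · rintro ⟨j, -, rfl⟩
    exact ⟨(hQ j).1, dvd_prod_of_mem _ (mem_univ j)⟩

/-- A product of `k` distinct nonzero prime ideals has exactly `k` prime ideal factors. [folklore] -/
theorem card_primeFactorsFinset_prod {k : ℕ} {Q : Fin k → Ideal (𝓞 K)}
    (hQ : ∀ j, (Q j).IsPrime ∧ Q j ≠ ⊥) (hinj : Function.Injective Q) :
    #(primeFactorsFinset (∏ j, Q j)) = k := by
  classical
  rw [primeFactorsFinset_prod_eq_image hQ, card_image_of_injective _ hinj, card_univ, Fintype.card_fin]

end Elementary

section HatIndex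

variable {X τ : ℝ}

/-- **The hat indices of `Û₂^{(1)}`**: for `(n₁, n₂) ∈ nPairs` and `P_j ∈ 𝒥(n_j)` (`X > 1`,
`0 < τ ≤ 1/8`): both are first-degree primes of `𝒫₀`, `N(P₂) < N(P₁)`, `P₂ ≺ P₁`,
`X^τ ≤ X^{n₂ξ}`, `X^{1/2+2τ} ≤ X^{n₂ξ}`, `X^{3/2+τ} ≤ N(P₁P₂) < X^{2−2τ}`, and `({P₁}, P₂)` is an
index of `U₂^{(1)}`. [cite: HeathBrownActa2001, §3 p. 16] -/
theorem U2_index_props (hX : 1 < X) (hτ : 0 < τ) (hτ1 : τ ≤ 1 / 8) {nn : ℕ × ℕ}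
    (hnn : nn ∈ nPairs τ) {P₁ P₂ : Ideal (𝓞 K)} (hP₁ : P₁ ∈ Jprimes X τ nn.1)
    (hP₂ : P₂ ∈ Jprimes X τ nn.2) :
    (P₁.IsPrime ∧ P₁ ≠ ⊥ ∧ (Ideal.absNorm P₁).Prime ∧
      X ^ ((nn.1 : ℝ) * hbXi τ) ≤ (Ideal.absNorm P₁ : ℝ) ∧
      (Ideal.absNorm P₁ : ℝ) < X ^ (((nn.1 : ℝ) + 1) * hbXi τ)) ∧
    (P₂.IsPrime ∧ P₂ ≠ ⊥ ∧ (Ideal.absNorm P₂).Prime ∧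
      X ^ ((nn.2 : ℝ) * hbXi τ) ≤ (Ideal.absNorm P₂ : ℝ) ∧
      (Ideal.absNorm P₂ : ℝ) < X ^ (((nn.2 : ℝ) + 1) * hbXi τ)) ∧
    Ideal.absNorm P₂ < Ideal.absNorm P₁ ∧ PrimeLT P₂ P₁ ∧
    P₁ ∈ smallPrimes X τ ∧ P₂ ∈ smallPrimes X τ ∧
    X ^ τ ≤ X ^ ((nn.2 : ℝ) * hbXi τ) ∧ X ^ (1 / 2 + 2 * τ) ≤ X ^ ((nn.2 : ℝ) * hbXi τ) ∧
    X ^ (3 / 2 + τ) ≤ (Ideal.absNorm P₁ : ℝ) * Ideal.absNorm P₂ ∧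
    (Ideal.absNorm P₁ : ℝ) * Ideal.absNorm P₂ < X ^ (2 - 2 * τ) ∧
    (({P₁}, P₂) : Finset (Ideal (𝓞 K)) × Ideal (𝓞 K)) ∈ (Upairs X τ 1).filter
      (fun t => X ^ (3 / 2 + τ) ≤ ((Ideal.absNorm (∏ P ∈ t.1, P) * Ideal.absNorm t.2 : ℕ) : ℝ)) := by
  classical
  have hξ := hbXi_pos hτ
  have hX0 : 0 < X := by linarith
  obtain ⟨h2lo, h21, h1hi, hsum⟩ := mem_nPairs hnn
  obtain ⟨hp1, hp10, hlo1, hhi1, hpr1⟩ := (mem_Jprimes_iff X τ).mp hP₁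
  obtain ⟨hp2, hp20, hlo2, hhi2, hpr2⟩ := (mem_Jprimes_iff X τ).mp hP₂
  -- exponent facts
  have eτ : τ ≤ (nn.2 : ℝ) * hbXi τ := by rwa [div_le_iff₀ hξ] at h2lo
  have e21 : ((nn.2 : ℝ) + 1) * hbXi τ ≤ (nn.1 : ℝ) * hbXi τ := by
    refine mul_le_mul_of_nonneg_right ?_ hξ.le
    exact_mod_cast Nat.succ_le_of_lt h21
  have e1 : ((nn.1 : ℝ) + 1) * hbXi τ ≤ 1 - τ := by
    have := h1hi; rw [le_sub_iff_add_le, le_div_iff₀ hξ] at this; linarith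
  have esum : 3 / 2 + τ ≤ ((nn.1 : ℝ) + nn.2) * hbXi τ := by rwa [div_le_iff₀ hξ] at hsum
  have e2 : 1 / 2 + 2 * τ ≤ (nn.2 : ℝ) * hbXi τ := by nlinarith
  -- norms
  have hN21 : (Ideal.absNorm P₂ : ℝ) < Ideal.absNorm P₁ :=
    hhi2.trans_le ((Real.rpow_le_rpow_of_exponent_le hX.le e21).trans hlo1)
  have hN21' : Ideal.absNorm P₂ < Ideal.absNorm P₁ := by exact_mod_cast hN21
  have hLT : PrimeLT P₂ P₁ := primeLT_of_absNorm_lt hN21'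
  have hτ2 : X ^ τ ≤ X ^ ((nn.2 : ℝ) * hbXi τ) := Real.rpow_le_rpow_of_exponent_le hX.le eτ
  have hhalf : X ^ (1 / 2 + 2 * τ) ≤ X ^ ((nn.2 : ℝ) * hbXi τ) :=
    Real.rpow_le_rpow_of_exponent_le hX.le e2
  have hP1hi : (Ideal.absNorm P₁ : ℝ) < X ^ (1 - τ) :=
    hhi1.trans_le (Real.rpow_le_rpow_of_exponent_le hX.le e1)
  have hP2hi : (Ideal.absNorm P₂ : ℝ) < X ^ (1 - τ) := hN21.trans hP1hi
  have hP2lo : X ^ τ ≤ (Ideal.absNorm P₂ : ℝ) := hτ2.trans hlo2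
  have hP1lo : X ^ τ ≤ (Ideal.absNorm P₁ : ℝ) := hP2lo.trans hN21.le
  have hs1 : P₁ ∈ smallPrimes X τ := mem_smallPrimes_iff.mpr ⟨hp1, hp10, hP1lo, hP1hi⟩
  have hs2 : P₂ ∈ smallPrimes X τ := mem_smallPrimes_iff.mpr ⟨hp2, hp20, hP2lo, hP2hi⟩
  have hprodlo : X ^ (3 / 2 + τ) ≤ (Ideal.absNorm P₁ : ℝ) * Ideal.absNorm P₂ := by
    calc X ^ (3 / 2 + τ) ≤ X ^ (((nn.1 : ℝ) + nn.2) * hbXi τ) :=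
          Real.rpow_le_rpow_of_exponent_le hX.le esum
      _ = X ^ ((nn.1 : ℝ) * hbXi τ) * X ^ ((nn.2 : ℝ) * hbXi τ) := by
          rw [← Real.rpow_add hX0]; ring_nf
      _ ≤ (Ideal.absNorm P₁ : ℝ) * Ideal.absNorm P₂ :=
          mul_le_mul hlo1 hlo2 (Real.rpow_nonneg hX0.le _) (Nat.cast_nonneg _)
  have hprodhi : (Ideal.absNorm P₁ : ℝ) * Ideal.absNorm P₂ < X ^ (2 - 2 * τ) := by
    calc (Ideal.absNorm P₁ : ℝ) * Ideal.absNorm P₂ < X ^ (1 - τ) * X ^ (1 - τ) :=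
          mul_lt_mul'' hP1hi hP2hi (Nat.cast_nonneg _) (Nat.cast_nonneg _)
      _ = X ^ (2 - 2 * τ) := by rw [← Real.rpow_add hX0]; ring_nf
  have hX1τ : X ^ (1 + τ) ≤ X ^ (3 / 2 + τ) := Real.rpow_le_rpow_of_exponent_le hX.le (by linarith)
  refine ⟨⟨hp1, hp10, hpr1, hlo1, hhi1⟩, ⟨hp2, hp20, hpr2, hlo2, hhi2⟩, hN21', hLT, hs1, hs2, hτ2, hhalf,
    hprodlo, hprodhi, ?_⟩
  rw [mem_filter, mem_Upairs_iff, prod_singleton]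
  push_cast
  refine ⟨⟨mem_chains_iff.mpr ⟨by simpa using hs1, card_singleton _, ?_⟩, hs2, fun P hP => ?_, ?_⟩, hprodlo⟩
  · rw [prod_singleton]
    exact hP1hi.trans_le (Real.rpow_le_rpow_of_exponent_le hX.le (by linarith))
  · rw [mem_singleton] at hP; rw [hP]; exact hLT
  · exact hX1τ.trans hprodlo

/-- Uniqueness of the pair `(P₁, P₂) ∈ 𝒥(n₁) × 𝒥(n₂)` with a given product (`n₁ ≠ n₂`). [folklore] -/
theorem Jpair_eq_of_mul_eq (hX : 1 < X) (hτ : 0 < τ) {n₁ n₂ : ℕ} (hne : n₁ ≠ n₂)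
    {P₁ P₂ P₁' P₂' : Ideal (𝓞 K)} (hP₁ : P₁ ∈ Jprimes X τ n₁) (hP₂ : P₂ ∈ Jprimes X τ n₂)
    (hP₁' : P₁' ∈ Jprimes X τ n₁) (h : P₁ * P₂ = P₁' * P₂') :
    P₁ = P₁' ∧ P₂ = P₂' := by
  obtain ⟨hp1, hp10, -⟩ := (mem_Jprimes_iff X τ).mp hP₁
  obtain ⟨hp2, hp20, -⟩ := (mem_Jprimes_iff X τ).mp hP₂
  obtain ⟨hp1', hp10', -⟩ := (mem_Jprimes_iff X τ).mp hP₁'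
  have hpr : Prime P₁' := Ideal.prime_of_isPrime hp10' hp1'
  have hdvd : P₁' ∣ P₁ * P₂ := ⟨P₂', h⟩
  rcases hpr.dvd_or_dvd hdvd with h1 | h1
  · have hQQ : P₁ = P₁' := (hp1.isMaximal hp10).eq_of_le hp1'.ne_top (Ideal.le_of_dvd h1)
    subst hQQ
    exact ⟨rfl, mul_left_cancel₀ (show P₁ ≠ 0 from hp10) h⟩
  · exfalso
    have hPQ' : P₂ = P₁' := (hp2.isMaximal hp20).eq_of_le hp1'.ne_top (Ideal.le_of_dvd h1)
    subst hPQ'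
    exact hne (Jprimes_index_unique hX hτ hP₁' hP₂)

/-- The norm of `P₁P₂` with `P_j ∈ 𝒥(n_j)`, `n₁ ≠ n₂`, is square-free (two distinct primes).
[folklore] -/
theorem squarefree_absNorm_Jpair (hX : 1 < X) (hτ : 0 < τ) {n₁ n₂ : ℕ} (hne : n₁ ≠ n₂)
    {P₁ P₂ : Ideal (𝓞 K)} (hP₁ : P₁ ∈ Jprimes X τ n₁) (hP₂ : P₂ ∈ Jprimes X τ n₂) :
    Squarefree (Ideal.absNorm (P₁ * P₂)) := by
  obtain ⟨hp1, hp10, hlo1, hhi1, hpr1⟩ := (mem_Jprimes_iff X τ).mp hP₁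
  obtain ⟨hp2, hp20, hlo2, hhi2, hpr2⟩ := (mem_Jprimes_iff X τ).mp hP₂
  have hN : Ideal.absNorm P₁ ≠ Ideal.absNorm P₂ := by
    intro hEq
    have hP₂' : P₂ ∈ Jprimes X τ n₁ := by
      rw [mem_Jprimes_iff]
      refine ⟨hp2, hp20, ?_, ?_, hpr2⟩
      · rw [← hEq]; exact hlo1
      · rw [← hEq]; exact hhi1
    exact hne (Jprimes_index_unique hX hτ hP₂' hP₂)
  rw [map_mul, Nat.squarefree_mul ((Nat.coprime_primes hpr1 hpr2).mpr hN)]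
  exact ⟨hpr1.prime.squarefree, hpr2.prime.squarefree⟩

open scoped Classical in
/-- **The hat-side count of `Û₂^{(1)}` at one member.** For a nonzero member `I₀`, a nonzero `S₀`
and `n₁ ≠ n₂`: `∑_{RS' = I₀, S' = S₀} c_R` with `c = c2Coef n₁ n₂` equals the number of pairs
`(P₁, P₂) ∈ 𝒥(n₁) × 𝒥(n₂)` with `P₁P₂S₀ = I₀` (at most one). [cite: HeathBrownActa2001, §3 p. 16] -/
theorem sum_divisorPairs_c2Coef_eq (hX : 1 < X) (hτ : 0 < τ) {n₁ n₂ : ℕ} (hne : n₁ ≠ n₂)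
    {I₀ S₀ : Ideal (𝓞 K)} (hI : I₀ ≠ ⊥) (hS : S₀ ≠ ⊥) :
    (∑ RS ∈ divisorPairs I₀, if S₀ = RS.2 then c2Coef X τ n₁ n₂ RS.1 else 0) =
      ∑ pp ∈ Jprimes X τ n₁ ×ˢ Jprimes X τ n₂, if pp.1 * pp.2 * S₀ = I₀ then (1 : ℝ) else 0 := by
  classical
  by_cases hdvd : S₀ ∣ I₀
  · obtain ⟨R₀, hR₀⟩ := hdvd
    have hmem : (R₀, S₀) ∈ divisorPairs I₀ := by
      rw [mem_divisorPairs_iff hI]; rw [hR₀, mul_comm]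
    rw [sum_eq_single (R₀, S₀)]
    · simp only [if_true]
      -- the right side counts the pairs with product `R₀`
      have hiff : ∀ pp : Ideal (𝓞 K) × Ideal (𝓞 K), pp.1 * pp.2 * S₀ = I₀ ↔ pp.1 * pp.2 = R₀ := by
        intro pp
        rw [hR₀, mul_comm S₀ R₀]
        exact ⟨fun h => mul_right_cancel₀ (show S₀ ≠ 0 from hS) h, fun h => by rw [h]⟩
      simp_rw [hiff]
      rw [sum_boole]
      have hle1 : #((Jprimes X τ n₁ ×ˢ Jprimes X τ n₂).filter (fun pp => pp.1 * pp.2 = R₀)) ≤ 1 := by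
        refine card_le_one.mpr fun pp hpp qq hqq => ?_
        rw [mem_filter, mem_product] at hpp hqq
        obtain ⟨h1, h2⟩ := Jpair_eq_of_mul_eq hX hτ hne hpp.1.1 hpp.1.2 hqq.1.1 (hpp.2.trans hqq.2.symm)
        exact Prod.ext h1 h2
      unfold c2Coef
      by_cases hex : ∃ P₁ ∈ Jprimes X τ n₁, ∃ P₂ ∈ Jprimes X τ n₂, R₀ = P₁ * P₂
      · obtain ⟨P₁, hP₁, P₂, hP₂, rfl⟩ := hex
        rw [if_pos ⟨⟨P₁, hP₁, P₂, hP₂, rfl⟩, squarefree_absNorm_Jpair hX hτ hne hP₁ hP₂⟩]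
        have hmem' : (P₁, P₂) ∈ (Jprimes X τ n₁ ×ˢ Jprimes X τ n₂).filter (fun pp => pp.1 * pp.2 = P₁ * P₂) :=
          mem_filter.mpr ⟨mem_product.mpr ⟨hP₁, hP₂⟩, rfl⟩
        have hcard : #((Jprimes X τ n₁ ×ˢ Jprimes X τ n₂).filter (fun pp => pp.1 * pp.2 = P₁ * P₂)) = 1 :=
          le_antisymm hle1 (card_pos.mpr ⟨_, hmem'⟩)
        rw [hcard, Nat.cast_one]
      · rw [if_neg (fun h => hex h.1)]
        have hempty : (Jprimes X τ n₁ ×ˢ Jprimes X τ n₂).filter (fun pp => pp.1 * pp.2 = R₀) = ∅ := by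
          refine filter_eq_empty_iff.mpr fun pp hpp h => hex ?_
          rw [mem_product] at hpp
          exact ⟨pp.1, hpp.1, pp.2, hpp.2, h.symm⟩
        rw [hempty, card_empty, Nat.cast_zero]
    · intro RS hRS hne'
      rw [mem_divisorPairs_iff hI] at hRS
      split_ifs with h
      · exfalso
        apply hne'
        have h1 : RS.1 * S₀ = R₀ * S₀ := by
          calc RS.1 * S₀ = RS.1 * RS.2 := by rw [← h]
            _ = I₀ := hRS
            _ = S₀ * R₀ := hR₀
            _ = R₀ * S₀ := mul_comm _ _
        have h2 : RS.1 = R₀ := mul_right_cancel₀ (show S₀ ≠ 0 from hS) h1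
        exact Prod.ext h2 h.symm
      · rfl
    · intro h; exact absurd hmem h
  · have hL : (∑ RS ∈ divisorPairs I₀, if S₀ = RS.2 then c2Coef X τ n₁ n₂ RS.1 else 0) = 0 := by
      refine sum_eq_zero fun RS hRS => ?_
      rw [mem_divisorPairs_iff hI] at hRS
      split_ifs with h
      · exact absurd ⟨RS.1, by rw [h, ← hRS, mul_comm]⟩ hdvd
      · rfl
    have hR : (∑ pp ∈ Jprimes X τ n₁ ×ˢ Jprimes X τ n₂, if pp.1 * pp.2 * S₀ = I₀ then (1 : ℝ) else 0) = 0 := by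
      refine sum_eq_zero fun pp _ => ?_
      split_ifs with h
      · exact absurd ⟨pp.1 * pp.2, by rw [← h, mul_comm]⟩ hdvd
      · rfl
    rw [hL, hR]

open scoped Classical in
/-- **`Û₂^{(1)}` as a sum over the hat indices `((n₁, n₂), P₁, P₂)`**: for each such index the
weighted count `∑_{(n, 𝐦, (Q_j))} (∏ log N(Q_j)/(m_jξ log X)) · #{i : P₁P₂Q₁⋯Q_{n+1} = I_i}` over
the vectors `𝐦` of `Û₂^{(1)}` with `m_{n+1} ≥ n₂` and the tuples `Q_j ∈ 𝒥(m_j)` (p. 16: "If we now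
define `Û^{(𝐦,n)}(𝒜) = ∑_{R = P₁P₂} ∑_{S = Q₁⋯Q_{n+1}, RS ∈ 𝒜} ∏ log N(Q_i)/(m_iξ log X)` we may
approximate `U₂^{(1)}(𝒜)` by `∑_{n,𝐦} Û^{(𝐦,n)}(𝒜)`"). [cite: HeathBrownActa2001, §3 p. 16] -/
theorem U2hat_eq_sum {ι : Type*} (E : Finset ι) (I : ι → Ideal (𝓞 K)) (hX : 1 < X) (hτ : 0 < τ)
    (h0 : ∀ i ∈ E, I i ≠ ⊥) :
    U2hat X τ E I = ∑ b ∈ (nPairs τ).sigma (fun nn => Jprimes X τ nn.1 ×ˢ Jprimes X τ nn.2),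
      ∑ y ∈ ((range (u2Bound τ + 1)).sigma (fun n => mIndexU2 τ n b.1.2)).sigma
          (fun x => Fintype.piFinset fun j => Jprimes X τ (x.2 j)),
        (∏ j, Real.log (Ideal.absNorm (y.2 j)) / ((y.1.2 j : ℝ) * hbXi τ * Real.log X)) *
          #{i ∈ E | b.2.1 * b.2.2 * ∏ j, y.2 j = I i} := by
  classical
  rw [U2hat, sum_sigma]
  refine sum_congr rfl fun nn hnn => ?_
  obtain ⟨-, h21, -⟩ := mem_nPairs hnn
  have hne : nn.1 ≠ nn.2 := by omega
  -- expand each bilinear sum over tuples and pairs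
  have key : ∀ (n : ℕ), ∀ m ∈ mIndexU2 τ n nn.2,
      bilin E I (c2Coef X τ nn.1 nn.2) (dWeight X τ m) =
        ∑ pp ∈ Jprimes X τ nn.1 ×ˢ Jprimes X τ nn.2,
          ∑ Q ∈ Fintype.piFinset (fun j => Jprimes X τ (m j)),
            (∏ j, Real.log (Ideal.absNorm (Q j)) / ((m j : ℝ) * hbXi τ * Real.log X)) *
              #{i ∈ E | pp.1 * pp.2 * ∏ j, Q j = I i} := by
    intro n m hm
    rw [bilin_dWeight_eq_sum_tuples, sum_comm]
    refine sum_congr rfl fun Q hQ => ?_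
    have hJ := fun j => (mem_Jprimes_iff X τ).mp (Fintype.mem_piFinset.mp hQ j)
    have hS : (∏ j, Q j) ≠ ⊥ := by
      refine Finset.prod_ne_zero_iff.mpr fun j _ => ?_
      rw [Ne, Ideal.zero_eq_bot]; exact (hJ j).2.1
    have hinner : ∀ i ∈ E, (∑ RS ∈ divisorPairs (I i),
        if ∏ j, Q j = RS.2 then c2Coef X τ nn.1 nn.2 RS.1 else 0) =
        ∑ pp ∈ Jprimes X τ nn.1 ×ˢ Jprimes X τ nn.2, if pp.1 * pp.2 * ∏ j, Q j = I i then (1 : ℝ) else 0 :=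
      fun i hi => sum_divisorPairs_c2Coef_eq hX hτ hne (h0 i hi) hS
    rw [sum_congr rfl hinner, sum_comm, mul_sum]
    refine sum_congr rfl fun pp _ => ?_
    rw [sum_boole]
  -- rewrite the right side as an iterated sum and commute
  dsimp only
  rw [sum_comm, sum_sigma, sum_sigma]
  refine sum_congr rfl fun n _ => sum_congr rfl fun m hm => ?_
  rw [key n m hm, sum_comm]

end HatIndex

section Tuples

variable {X τ : ℝ}

/-- `2ξ ≤ τ` for `0 < τ ≤ 1/2` (`ξ = τ⁵`). [folklore] -/
theorem two_mul_hbXi_le (hτ : 0 < τ) (hτ1 : τ ≤ 1 / 2) : 2 * hbXi τ ≤ τ := by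
  rw [hbXi]
  have h4 : τ ^ 4 ≤ (1 / 2) ^ 4 := pow_le_pow_left₀ hτ.le hτ1 4
  have h5 : τ ^ 5 = τ * τ ^ 4 := by ring
  rw [h5]
  nlinarith

/-- **The tuples `(𝐦, (Q_j))` of `Û₂^{(1)}`** (`𝐦 ∈ mIndexU2 τ n n₂`, `Q_j ∈ 𝒥(m_j)`): each `Q_j` is a
nonzero first-degree prime with `X^{m_jξ} ≤ N(Q_j) < X^{(m_j+1)ξ}`, `n₂ ≤ m_j` (so
`N(Q_j) ≥ X^{n₂ξ}`), `𝐦` and the norms are strictly decreasing, and `m_j ≥ τξ^{-1}`.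
[cite: HeathBrownActa2001, §3 pp. 16–17] -/
theorem U2_tuple_props (hX : 1 < X) (hτ : 0 < τ) {n n₂ : ℕ} {m : Fin (n + 1) → ℕ}
    (hm : m ∈ mIndexU2 τ n n₂) {Q : Fin (n + 1) → Ideal (𝓞 K)}
    (hQ : Q ∈ Fintype.piFinset fun j => Jprimes X τ (m j)) :
    (∀ j, (Q j).IsPrime ∧ Q j ≠ ⊥ ∧ (Ideal.absNorm (Q j)).Prime ∧
      X ^ ((m j : ℝ) * hbXi τ) ≤ (Ideal.absNorm (Q j) : ℝ) ∧
      (Ideal.absNorm (Q j) : ℝ) < X ^ (((m j : ℝ) + 1) * hbXi τ)) ∧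
    (∀ j, n₂ ≤ m j) ∧ (∀ j, X ^ ((n₂ : ℝ) * hbXi τ) ≤ (Ideal.absNorm (Q j) : ℝ)) ∧
    StrictAnti m ∧ (StrictAnti fun j => Ideal.absNorm (Q j)) ∧ Function.Injective Q ∧
    (∀ j, τ / hbXi τ ≤ (m j : ℝ)) := by
  have hξ := hbXi_pos hτ
  obtain ⟨⟨hanti, h5, -, -⟩, hlast⟩ := (mem_mIndexU2_iff hτ).mp hm
  have hJ := fun j => (mem_Jprimes_iff X τ).mp (Fintype.mem_piFinset.mp hQ j)
  have hmj : ∀ j, n₂ ≤ m j := fun j => hlast.trans (hanti.antitone (Fin.le_last j))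
  have hSA := strictAnti_absNorm_of_mem_piFinset hX hτ hanti hQ
  refine ⟨fun j => ⟨(hJ j).1, (hJ j).2.1, (hJ j).2.2.2.2, (hJ j).2.2.1, (hJ j).2.2.2.1⟩, hmj,
    fun j => ?_, hanti, hSA, fun a b hab => hSA.injective ?_, h5⟩
  · refine le_trans (Real.rpow_le_rpow_of_exponent_le hX.le ?_) (hJ j).2.2.1
    exact mul_le_mul_of_nonneg_right (by exact_mod_cast hmj j) hξ.le
  · show Ideal.absNorm (Q a) = Ideal.absNorm (Q b)
    rw [hab]

/-- **Uniqueness of the tuple of `Û₂^{(1)}` behind a member**: two hat tuples `(n, 𝐦, (Q_j))`,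
`(n', 𝐦', (Q'_j))` with `R·∏Q_j = R·∏Q'_j` (`R ≠ 0`) coincide — the product determines the number of
its prime factors, and then the tuple ((3.5): the `S` are square-free). [cite: HeathBrownActa2001, §3 (3.5)] -/
theorem U2_tuple_unique (hX : 1 < X) (hτ : 0 < τ) {N n₂ : ℕ} {R : Ideal (𝓞 K)} (hR : R ≠ ⊥)
    {y y' : Σ x : (Σ _n : ℕ, Fin (_n + 1) → ℕ), Fin (x.1 + 1) → Ideal (𝓞 K)}
    (hy : y ∈ ((range N).sigma (fun n => mIndexU2 τ n n₂)).sigma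
        (fun x => Fintype.piFinset fun j => Jprimes X τ (x.2 j)))
    (hy' : y' ∈ ((range N).sigma (fun n => mIndexU2 τ n n₂)).sigma
        (fun x => Fintype.piFinset fun j => Jprimes X τ (x.2 j)))
    (h : R * ∏ j, y.2 j = R * ∏ j, y'.2 j) : y = y' := by
  obtain ⟨⟨n, m⟩, Q⟩ := y
  obtain ⟨⟨n', m'⟩, Q'⟩ := y'
  simp only [mem_sigma] at hy hy'
  have hprod : ∏ j, Q j = ∏ j, Q' j := mul_left_cancel₀ (show R ≠ 0 from hR) h
  obtain ⟨hJ, -, -, hanti, -, hinj, -⟩ := U2_tuple_props hX hτ hy.1.2 hy.2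
  obtain ⟨hJ', -, -, hanti', -, hinj', -⟩ := U2_tuple_props hX hτ hy'.1.2 hy'.2
  have hn : n = n' := by
    have h1 := card_primeFactorsFinset_prod (fun j => ⟨(hJ j).1, (hJ j).2.1⟩) hinj
    have h2 := card_primeFactorsFinset_prod (fun j => ⟨(hJ' j).1, (hJ' j).2.1⟩) hinj'
    have h3 : n + 1 = n' + 1 := by rw [← h1, ← h2]; exact congrArg _ (congrArg _ hprod)
    omega
  subst hn
  obtain ⟨hQQ, hmm⟩ := tuple_eq_of_prod_eq hX hτ hanti hanti' hy.2 hy'.2 hprod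
  subst hQQ; subst hmm; rfl

/-- The product `P₁P₂·∏Q_j` behind a hat term of `Û₂^{(1)}` is `X^{n₂ξ}`-rough and nonzero. [folklore] -/
theorem U2_prod_isRough (hX : 1 < X) (hτ : 0 < τ) (hτ1 : τ ≤ 1 / 8) {nn : ℕ × ℕ}
    (hnn : nn ∈ nPairs τ) {P₁ P₂ : Ideal (𝓞 K)} (hP₁ : P₁ ∈ Jprimes X τ nn.1)
    (hP₂ : P₂ ∈ Jprimes X τ nn.2) {n : ℕ} {m : Fin (n + 1) → ℕ} (hm : m ∈ mIndexU2 τ n nn.2)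
    {Q : Fin (n + 1) → Ideal (𝓞 K)} (hQ : Q ∈ Fintype.piFinset fun j => Jprimes X τ (m j)) :
    IsRough (X ^ ((nn.2 : ℝ) * hbXi τ)) (P₁ * P₂ * ∏ j, Q j) ∧ P₁ * P₂ * ∏ j, Q j ≠ ⊥ := by
  obtain ⟨⟨hp1, hp10, -, hlo1, -⟩, ⟨hp2, hp20, -, hlo2, -⟩, hN21, -⟩ := U2_index_props hX hτ hτ1 hnn hP₁ hP₂
  obtain ⟨hJ, -, hge, -⟩ := U2_tuple_props hX hτ hm hQ
  have hN21' : (Ideal.absNorm P₂ : ℝ) ≤ Ideal.absNorm P₁ := by exact_mod_cast hN21.le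
  refine ⟨?_, ?_⟩
  · rw [isRough_mul_iff, isRough_mul_iff]
    exact ⟨⟨isRough_of_isPrime hp1 hp10 (hlo2.trans hN21'), isRough_of_isPrime hp2 hp20 hlo2⟩,
      isRough_prod_of_le (fun j => ⟨(hJ j).1, (hJ j).2.1⟩) hge⟩
  · refine mul_ne_zero (mul_ne_zero hp10 hp20) ?_
    exact Finset.prod_ne_zero_iff.mpr fun j _ => (hJ j).2.1

/-- **The Buchstab range of `Û₂^{(1)}` is a close or equal-norm pair.** If a hat term
`I = P₁P₂Q₁⋯Q_{n+1}` has a prime factor `Q' ≺ P₂` (so that it is not counted by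
`S_K^≺(𝒵_{P₁P₂}, P₂)`), then `Q' = Q_j` for some `j`, `X^{n₂ξ} ≤ N(Q_j) ≤ N(P₂) < X^{(n₂+1)ξ}`: either
`N(Q_j) = N(P₂)` (two distinct primes of equal norm divide `I`) or `(Q_j, P₂)` is a close pair
`N(Q_j) < N(P₂) < N(Q_j)X^ξ` of first-degree primes dividing `I` (p. 47: "replace
`S_K(𝒜_{P₁P₂}, N(P₂))` by `S_K(𝒜_{P₁P₂}, X^{n₂ξ})` … the errors here are estimated just as before").
[cite: HeathBrownActa2001, §7 pp. 46–47] -/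
theorem U2_close_or_eq_of_primeLT (hX : 1 < X) (hτ : 0 < τ) (hτ1 : τ ≤ 1 / 8) {nn : ℕ × ℕ}
    (hnn : nn ∈ nPairs τ) {P₁ P₂ : Ideal (𝓞 K)} (hP₁ : P₁ ∈ Jprimes X τ nn.1)
    (hP₂ : P₂ ∈ Jprimes X τ nn.2) {n : ℕ} {m : Fin (n + 1) → ℕ} (hm : m ∈ mIndexU2 τ n nn.2)
    {Q : Fin (n + 1) → Ideal (𝓞 K)} (hQ : Q ∈ Fintype.piFinset fun j => Jprimes X τ (m j))
    {Q' : Ideal (𝓞 K)} (hQ'p : Q'.IsPrime) (hQ'd : Q' ∣ P₁ * P₂ * ∏ j, Q j) (hlt : PrimeLT Q' P₂) :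
    (∃ A B : Ideal (𝓞 K), A.IsPrime ∧ A ≠ ⊥ ∧ B.IsPrime ∧ B ≠ ⊥ ∧ (Ideal.absNorm A).Prime ∧
        (Ideal.absNorm B).Prime ∧ A * B ∣ P₁ * P₂ * ∏ j, Q j ∧
        X ^ (1 / 2 : ℝ) ≤ (Ideal.absNorm A : ℝ) ∧ Ideal.absNorm A < Ideal.absNorm B ∧
        (Ideal.absNorm B : ℝ) < Ideal.absNorm A * X ^ hbXi τ ∧ (Ideal.absNorm B : ℝ) < X ^ (1 - τ)) ∨
    (∃ A B : Ideal (𝓞 K), A.IsPrime ∧ A ≠ ⊥ ∧ B.IsPrime ∧ B ≠ ⊥ ∧ A ≠ B ∧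
        Ideal.absNorm A = Ideal.absNorm B ∧ A * B ∣ P₁ * P₂ * ∏ j, Q j ∧
        X ^ (1 / 2 : ℝ) ≤ (Ideal.absNorm A : ℝ)) := by
  have hX0 : 0 < X := by linarith
  obtain ⟨⟨hp1, hp10, hpr1, hlo1, hhi1⟩, ⟨hp2, hp20, hpr2, hlo2, hhi2⟩, hN21, hLT, hs1, hs2, hτ2, hhalf,
    -⟩ := U2_index_props hX hτ hτ1 hnn hP₁ hP₂
  obtain ⟨hJ, hmj, hge, -⟩ := U2_tuple_props hX hτ hm hQ
  obtain ⟨-, hprod0⟩ := U2_prod_isRough hX hτ hτ1 hnn hP₁ hP₂ hm hQ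
  have hQ'0 : Q' ≠ ⊥ := by
    rintro rfl
    have h1 : (0 : Ideal (𝓞 K)) ∣ P₁ * P₂ * ∏ j, Q j := by rwa [Ideal.zero_eq_bot]
    exact hprod0 (by have := zero_dvd_iff.mp h1; rwa [Ideal.zero_eq_bot] at this)
  have hpr : Prime Q' := Ideal.prime_of_isPrime hQ'0 hQ'p
  have hP2hi : (Ideal.absNorm P₂ : ℝ) < X ^ (1 - τ) := (mem_smallPrimes_iff.mp hs2).2.2.2
  have hhalfX : X ^ (1 / 2 : ℝ) ≤ X ^ ((nn.2 : ℝ) * hbXi τ) :=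
    le_trans (Real.rpow_le_rpow_of_exponent_le hX.le (by linarith)) hhalf
  -- `Q'` is one of the `Q_j`
  obtain ⟨j, hj⟩ : ∃ j, Q' = Q j := by
    rcases hpr.dvd_or_dvd hQ'd with h1 | h1
    · exfalso
      rcases hpr.dvd_or_dvd h1 with h2 | h2
      · have : Q' = P₁ := ((hp1.isMaximal hp10).eq_of_le hQ'p.ne_top (Ideal.le_of_dvd h2)).symm
        rw [this] at hlt
        exact primeLT_irrefl _ (hlt.trans hLT)
      · have : Q' = P₂ := ((hp2.isMaximal hp20).eq_of_le hQ'p.ne_top (Ideal.le_of_dvd h2)).symm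
        rw [this] at hlt
        exact primeLT_irrefl _ hlt
    · obtain ⟨j, -, hj⟩ := hpr.exists_mem_finset_dvd h1
      exact ⟨j, (((hJ j).1.isMaximal (hJ j).2.1).eq_of_le hQ'p.ne_top (Ideal.le_of_dvd hj)).symm⟩
  subst hj
  have hdvd2 : Q j * P₂ ∣ P₁ * P₂ * ∏ i, Q i := by
    rw [mul_comm (Q j) P₂]
    exact mul_dvd_mul (dvd_mul_left P₂ P₁) (dvd_prod_of_mem _ (mem_univ j))
  have hhalfQ : X ^ (1 / 2 : ℝ) ≤ (Ideal.absNorm (Q j) : ℝ) := hhalfX.trans (hge j)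
  have hle : Ideal.absNorm (Q j) ≤ Ideal.absNorm P₂ := hlt.absNorm_le
  rcases hle.eq_or_lt with h | h
  · exact Or.inr ⟨Q j, P₂, (hJ j).1, (hJ j).2.1, hp2, hp20, hlt.ne, h, hdvd2, hhalfQ⟩
  · refine Or.inl ⟨Q j, P₂, (hJ j).1, (hJ j).2.1, hp2, hp20, (hJ j).2.2.1, hpr2, hdvd2, hhalfQ, h, ?_, hP2hi⟩
    calc (Ideal.absNorm P₂ : ℝ) < X ^ (((nn.2 : ℝ) + 1) * hbXi τ) := hhi2
      _ = X ^ ((nn.2 : ℝ) * hbXi τ) * X ^ hbXi τ := by rw [← Real.rpow_add hX0]; ring_nf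
      _ ≤ Ideal.absNorm (Q j) * X ^ hbXi τ :=
          mul_le_mul_of_nonneg_right (hge j) (Real.rpow_nonneg hX0.le _)

end Tuples

section Construction

variable {X τ : ℝ}

/-- Exponent comparison: `X^a ≤ c` and `c < X^b` force `a < b` (`X > 1`). [folklore] -/
theorem exp_lt_of_rpow_le_of_lt {X a b c : ℝ} (hX : 1 < X) (h1 : X ^ a ≤ c) (h2 : c < X ^ b) : a < b :=
  (Real.rpow_lt_rpow_left_iff hX).mp (h1.trans_lt h2)

/-- Exponent comparison: `X^a < X^b · c⁻¹ …` in the form `X^a ≤ c ≤ X^b` gives `a ≤ b` (`X > 1`). [folklore] -/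
theorem exp_le_of_rpow_le_of_le {X a b c : ℝ} (hX : 1 < X) (h1 : X ^ a ≤ c) (h2 : c ≤ X ^ b) : a ≤ b :=
  (Real.rpow_le_rpow_left_iff hX).mp (h1.trans h2)

/-- **The cofactor of an exactly counted member is a hat tuple** (the converse direction of the
approximation of `U₂^{(1)}` by `Û₂^{(1)}`, pp. 16–17 with p. 43: "the net effect of these estimates is
that we may restrict the prime ideals … so that `N(Q_i) ∈ J(m_i)`, with integers `m_i` satisfying
(3.5), (3.6) and the other relevant conditions"). Let `((n₁,n₂), P₁, P₂)` be a hat index away from the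
product window (`N(P₁P₂) ≥ C_N X^{3/2+τ+2ξ}`) and `J₀` a member with `X³ < N(J₀) ≤ C_N X³`,
`P₁P₂ ∣ J₀`, all of whose prime factors are `⊀ P₂`, and which has none of the four defects (a close
pair or an equal-norm pair of prime factors `≥ X^{1/2}`, a prime factor of degree `≥ 2`, a square
factor). Then `J₀ = P₁P₂Q₁⋯Q_{n+1}` for a tuple of `Û₂^{(1)}`: the cofactor has at most two prime
factors (each of norm `≥ N(P₂) ≥ X^{1/2+2τ}`, total norm `≤ X^{3/2−τ−2ξ}`), they are first-degree of
distinct, non-close norms, hence lie in boxes `𝒥(m₁)`, `𝒥(m₂)` with `m₁ > m₂ ≥ n₂`, and (3.6), (3.7)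
follow from `X^{1+2τ} < N(Q₁⋯) ≤ X^{3/2−τ−2ξ}`. [cite: HeathBrownActa2001, §7 pp. 43–47] -/
theorem U2_exists_tuple (hX : 1 < X) (hτ : 0 < τ) (hτ1 : τ ≤ 1 / 8) {CN : ℝ}
    {nn : ℕ × ℕ} (hnn : nn ∈ nPairs τ) {P₁ P₂ : Ideal (𝓞 K)} (hP₁ : P₁ ∈ Jprimes X τ nn.1)
    (hP₂ : P₂ ∈ Jprimes X τ nn.2)
    (hwin : CN * X ^ (3 / 2 + τ + 2 * hbXi τ) ≤ (Ideal.absNorm P₁ : ℝ) * Ideal.absNorm P₂)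
    {J₀ : Ideal (𝓞 K)} (hJlo : X ^ 3 < (Ideal.absNorm J₀ : ℝ))
    (hJhi : (Ideal.absNorm J₀ : ℝ) ≤ CN * X ^ 3) (hdvd : P₁ * P₂ ∣ J₀)
    (habove : ∀ ⦃Q' : Ideal (𝓞 K)⦄, Q'.IsPrime → Q' ∣ J₀ → ¬ PrimeLT Q' P₂)
    (hnclose : ¬ ∃ A B : Ideal (𝓞 K), A.IsPrime ∧ A ≠ ⊥ ∧ B.IsPrime ∧ B ≠ ⊥ ∧
        (Ideal.absNorm A).Prime ∧ (Ideal.absNorm B).Prime ∧ A * B ∣ J₀ ∧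
        X ^ (1 / 2 : ℝ) ≤ (Ideal.absNorm A : ℝ) ∧ Ideal.absNorm A < Ideal.absNorm B ∧
        (Ideal.absNorm B : ℝ) < Ideal.absNorm A * X ^ hbXi τ ∧ (Ideal.absNorm B : ℝ) < X ^ (1 - τ))
    (hneq : ¬ ∃ A B : Ideal (𝓞 K), A.IsPrime ∧ A ≠ ⊥ ∧ B.IsPrime ∧ B ≠ ⊥ ∧ A ≠ B ∧
        Ideal.absNorm A = Ideal.absNorm B ∧ A * B ∣ J₀ ∧ X ^ (1 / 2 : ℝ) ≤ (Ideal.absNorm A : ℝ))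
    (hndeg : ¬ ∃ A : Ideal (𝓞 K), A.IsPrime ∧ A ≠ ⊥ ∧ ¬ (Ideal.absNorm A).Prime ∧ A ∣ J₀ ∧
        X ^ (1 / 2 : ℝ) ≤ (Ideal.absNorm A : ℝ))
    (hnsq : ¬ ∃ A : Ideal (𝓞 K), A.IsPrime ∧ A ≠ ⊥ ∧ (Ideal.absNorm A).Prime ∧ A * A ∣ J₀ ∧
        X ^ (1 / 2 : ℝ) ≤ (Ideal.absNorm A : ℝ) ∧ (Ideal.absNorm A : ℝ) < X ^ (1 - τ)) :
    ∃ y ∈ ((range (u2Bound τ + 1)).sigma (fun n => mIndexU2 τ n nn.2)).sigma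
        (fun x => Fintype.piFinset fun j => Jprimes X τ (x.2 j)),
      P₁ * P₂ * ∏ j, y.2 j = J₀ := by
  classical
  have hξ := hbXi_pos hτ
  have hX0 : 0 < X := by linarith
  have hξτ : 2 * hbXi τ ≤ τ := two_mul_hbXi_le hτ (by linarith)
  obtain ⟨⟨hp1, hp10, hpr1, hlo1, hhi1⟩, ⟨hp2, hp20, hpr2, hlo2, hhi2⟩, hN21, hLT, hs1, hs2, hτ2, hhalf,
    hprodlo, hprodhi, -⟩ := U2_index_props hX hτ hτ1 hnn hP₁ hP₂
  obtain ⟨h2lo, -, -, -⟩ := mem_nPairs hnn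
  have hP2hi : (Ideal.absNorm P₂ : ℝ) < X ^ (1 - τ) := (mem_smallPrimes_iff.mp hs2).2.2.2
  have hhalfX : X ^ (1 / 2 : ℝ) ≤ X ^ ((nn.2 : ℝ) * hbXi τ) :=
    le_trans (Real.rpow_le_rpow_of_exponent_le hX.le (by linarith)) hhalf
  set R := P₁ * P₂ with hR
  obtain ⟨S, hS⟩ := hdvd
  have hNR : (Ideal.absNorm R : ℝ) = Ideal.absNorm P₁ * Ideal.absNorm P₂ := by
    rw [hR, map_mul, Nat.cast_mul]
  have hNJ : (Ideal.absNorm J₀ : ℝ) = Ideal.absNorm R * Ideal.absNorm S := by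
    rw [hS, map_mul, Nat.cast_mul]
  have hNRpos : (0 : ℝ) < Ideal.absNorm R := by
    rw [hNR]; exact mul_pos (by exact_mod_cast hpr1.pos) (by exact_mod_cast hpr2.pos)
  have hX3 : X ^ 3 = X ^ (3 : ℝ) := pow_three_eq_rpow X
  -- (α) `N(S) > X^{1+2τ}`
  have hSlo : X ^ (1 + 2 * τ) < (Ideal.absNorm S : ℝ) := by
    by_contra hcon
    push Not at hcon
    have h1 : (Ideal.absNorm J₀ : ℝ) ≤ Ideal.absNorm R * X ^ (1 + 2 * τ) := by
      rw [hNJ]; exact mul_le_mul_of_nonneg_left hcon hNRpos.le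
    have h2 : Ideal.absNorm R * X ^ (1 + 2 * τ) < X ^ (2 - 2 * τ) * X ^ (1 + 2 * τ) :=
      mul_lt_mul_of_pos_right (by rw [hNR]; exact hprodhi) (Real.rpow_pos_of_pos hX0 _)
    have h3 : X ^ (2 - 2 * τ) * X ^ (1 + 2 * τ) = X ^ 3 := by
      rw [← Real.rpow_add hX0, hX3]; norm_num
    linarith
  -- (β) `N(S) ≤ X^{3/2−τ−2ξ}`
  have hShi : (Ideal.absNorm S : ℝ) ≤ X ^ (3 / 2 - τ - 2 * hbXi τ) := by
    have h1 : Ideal.absNorm R * (Ideal.absNorm S : ℝ) ≤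
        Ideal.absNorm R * X ^ (3 / 2 - τ - 2 * hbXi τ) := by
      calc Ideal.absNorm R * (Ideal.absNorm S : ℝ) = Ideal.absNorm J₀ := hNJ.symm
        _ ≤ CN * X ^ 3 := hJhi
        _ = CN * X ^ (3 / 2 + τ + 2 * hbXi τ) * X ^ (3 / 2 - τ - 2 * hbXi τ) := by
            rw [mul_assoc, ← Real.rpow_add hX0, hX3]; ring_nf
        _ ≤ Ideal.absNorm R * X ^ (3 / 2 - τ - 2 * hbXi τ) := by
            rw [hNR]; exact mul_le_mul_of_nonneg_right hwin (Real.rpow_nonneg hX0.le _)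
    exact le_of_mul_le_mul_left h1 hNRpos
  -- prime factors of `S`: not preceding `P₂`, hence large and (no degree-2 defect) first degree
  have hSJ : S ∣ J₀ := ⟨R, by rw [hS, mul_comm]⟩
  have hJ0 : J₀ ≠ ⊥ := by
    intro h
    rw [h, Ideal.absNorm_bot, Nat.cast_zero] at hJlo
    linarith [pow_pos hX0 3]
  have hfac : ∀ Q' : Ideal (𝓞 K), Q'.IsPrime → Q' ∣ S →
      Q' ≠ ⊥ ∧ (Ideal.absNorm P₂ : ℝ) ≤ Ideal.absNorm Q' ∧ (Ideal.absNorm Q').Prime ∧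
        X ^ (1 / 2 : ℝ) ≤ (Ideal.absNorm Q' : ℝ) ∧ Q' ∣ J₀ := by
    intro Q' hQ' hQ'S
    have hQ'J : Q' ∣ J₀ := hQ'S.trans hSJ
    have hQ'0 : Q' ≠ ⊥ := by
      rintro rfl
      have h1 : (0 : Ideal (𝓞 K)) ∣ J₀ := by rwa [Ideal.zero_eq_bot]
      exact hJ0 (by have := zero_dvd_iff.mp h1; rwa [Ideal.zero_eq_bot] at this)
    have hge : (Ideal.absNorm P₂ : ℝ) ≤ Ideal.absNorm Q' := by
      rcases not_primeLT_iff.mp (habove hQ' hQ'J) with h | h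
      · exact_mod_cast h.absNorm_le
      · rw [h]
    have hhalfQ : X ^ (1 / 2 : ℝ) ≤ (Ideal.absNorm Q' : ℝ) := hhalfX.trans (hlo2.trans hge)
    have hprime : (Ideal.absNorm Q').Prime := by
      by_contra h
      exact hndeg ⟨Q', hQ', hQ'0, h, hQ'J, hhalfQ⟩
    exact ⟨hQ'0, hge, hprime, hhalfQ, hQ'J⟩
  -- the first prime factor
  have hS1 : S ≠ ⊤ := by
    intro h1
    rw [h1, Ideal.mul_top] at hS
    have h2 : (Ideal.absNorm J₀ : ℝ) < X ^ (2 - 2 * τ) := by rw [hS, hNR]; exact hprodhi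
    have h3 : X ^ (2 - 2 * τ) ≤ X ^ 3 := by
      rw [hX3]; exact Real.rpow_le_rpow_of_exponent_le hX.le (by linarith)
    linarith
  obtain ⟨Q₀, hQ₀max, hSQ₀⟩ := Ideal.exists_le_maximal S hS1
  have hQ₀p := hQ₀max.isPrime
  obtain ⟨S₁, hS₁⟩ := Ideal.dvd_iff_le.mpr hSQ₀
  obtain ⟨hQ₀0, hQ₀ge, hQ₀pr, hQ₀half, hQ₀J⟩ := hfac Q₀ hQ₀p ⟨S₁, hS₁⟩
  -- useful: norm bounds give exponent bounds
  have hu2 : 1 < u2Bound τ + 1 := by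
    have : 1 ≤ u2Bound τ := Nat.le_floor (by
      rw [Nat.cast_one, le_div_iff₀ (by positivity)]; linarith)
    omega
  by_cases hS₁top : S₁ = ⊤
  · -- one prime factor: `S = Q₀`
    have hSQ : S = Q₀ := by rw [hS₁, hS₁top, Ideal.mul_top]
    obtain ⟨m₀, hm₀⟩ := exists_mem_Jprimes hX hτ hQ₀p hQ₀0 hQ₀pr
    obtain ⟨-, -, hlo0, hhi0, -⟩ := (mem_Jprimes_iff X τ).mp hm₀
    rw [← hSQ] at hlo0 hhi0
    have e1 : (nn.2 : ℝ) * hbXi τ < ((m₀ : ℝ) + 1) * hbXi τ :=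
      exp_lt_of_rpow_le_of_lt hX (hlo2.trans (by rw [hSQ]; exact hQ₀ge)) hhi0
    have e2 : 1 + 2 * τ < ((m₀ : ℝ) + 1) * hbXi τ := exp_lt_of_rpow_le_of_lt hX hSlo.le hhi0
    have e3 : (m₀ : ℝ) * hbXi τ ≤ 3 / 2 - τ - 2 * hbXi τ := exp_le_of_rpow_le_of_le hX hlo0 hShi
    have hn2m : nn.2 ≤ m₀ := by
      have : (nn.2 : ℝ) < m₀ + 1 := lt_of_mul_lt_mul_right e1 hξ.le
      exact_mod_cast Nat.lt_succ_iff.mp (by exact_mod_cast this)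
    have hadm : CoreAdmissible τ (fun _ : Fin 1 => m₀) := by
      refine ⟨Subsingleton.strictAnti _, fun _ => h2lo.trans (by exact_mod_cast hn2m), ?_, ?_⟩
      · rw [Fin.sum_univ_one, div_le_iff₀ hξ]; linarith
      · rw [Fin.sum_univ_one, le_div_iff₀ hξ]; linarith
    have hmemM : (fun _ : Fin 1 => m₀) ∈ mIndexU2 τ 0 nn.2 := (mem_mIndexU2_iff hτ).mpr ⟨hadm, hn2m⟩
    have hmemQ : (fun _ : Fin 1 => Q₀) ∈
        Fintype.piFinset (fun j => Jprimes X τ ((fun _ : Fin 1 => m₀) j)) :=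
      Fintype.mem_piFinset.mpr fun _ => hm₀
    refine ⟨⟨⟨0, fun _ => m₀⟩, fun _ => Q₀⟩,
      mem_sigma.mpr ⟨mem_sigma.mpr ⟨mem_range.mpr (show 0 < u2Bound τ + 1 by omega), hmemM⟩, hmemQ⟩, ?_⟩
    show R * ∏ _j : Fin 1, Q₀ = J₀
    rw [Fin.prod_univ_one, hS, hSQ]
  · -- two prime factors: `S = Q₀Q₁`
    obtain ⟨Q₁, hQ₁max, hS₁Q₁⟩ := Ideal.exists_le_maximal S₁ hS₁top
    have hQ₁p := hQ₁max.isPrime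
    obtain ⟨S₂, hS₂⟩ := Ideal.dvd_iff_le.mpr hS₁Q₁
    have hQ₁S : Q₁ ∣ S := ⟨Q₀ * S₂, by rw [hS₁, hS₂]; ring⟩
    obtain ⟨hQ₁0, hQ₁ge, hQ₁pr, hQ₁half, hQ₁J⟩ := hfac Q₁ hQ₁p hQ₁S
    have hP2half : X ^ (1 / 2 + 2 * τ) ≤ (Ideal.absNorm P₂ : ℝ) := hhalf.trans hlo2
    have hXhalf1 : 1 ≤ X ^ (1 / 2 + 2 * τ) := Real.one_le_rpow hX.le (by linarith)
    -- no third factor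
    have hS₂top : S₂ = ⊤ := by
      by_contra h
      obtain ⟨Q₂, hQ₂max, hS₂Q₂⟩ := Ideal.exists_le_maximal S₂ h
      obtain ⟨S₃, hS₃⟩ := Ideal.dvd_iff_le.mpr hS₂Q₂
      have hQ₂S : Q₂ ∣ S := ⟨Q₀ * Q₁ * S₃, by rw [hS₁, hS₂, hS₃]; ring⟩
      obtain ⟨hQ₂0, hQ₂ge, -⟩ := hfac Q₂ hQ₂max.isPrime hQ₂S
      have hS₃0 : S₃ ≠ ⊥ := by
        rintro rfl
        apply hJ0
        rw [hS, hS₁, hS₂, hS₃]; simp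
      have hNS₃ : (1 : ℝ) ≤ Ideal.absNorm S₃ := by
        have : Ideal.absNorm S₃ ≠ 0 := fun h0 => hS₃0 (Ideal.absNorm_eq_zero_iff.mp h0)
        exact_mod_cast Nat.one_le_iff_ne_zero.mpr this
      have hNS : (Ideal.absNorm S : ℝ) =
          Ideal.absNorm Q₀ * Ideal.absNorm Q₁ * Ideal.absNorm Q₂ * Ideal.absNorm S₃ := by
        rw [hS₁, hS₂, hS₃]; simp only [map_mul, Nat.cast_mul]; ring
      have h3 : (X ^ (1 / 2 + 2 * τ)) ^ 3 ≤ (Ideal.absNorm S : ℝ) := by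
        calc (X ^ (1 / 2 + 2 * τ)) ^ 3
            = X ^ (1 / 2 + 2 * τ) * X ^ (1 / 2 + 2 * τ) * X ^ (1 / 2 + 2 * τ) * 1 := by ring
          _ ≤ Ideal.absNorm Q₀ * Ideal.absNorm Q₁ * Ideal.absNorm Q₂ * Ideal.absNorm S₃ := by
              have a0 := hP2half.trans hQ₀ge
              have a1 := hP2half.trans hQ₁ge
              have a2 := hP2half.trans hQ₂ge
              have hx0 : 0 ≤ X ^ (1 / 2 + 2 * τ) := by linarith
              gcongr
          _ = Ideal.absNorm S := hNS.symm
      have h4 : (X ^ (1 / 2 + 2 * τ)) ^ 3 = X ^ (3 / 2 + 6 * τ) := by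
        rw [← Real.rpow_natCast, ← Real.rpow_mul hX0.le]; ring_nf
      have h5 : X ^ (3 / 2 - τ - 2 * hbXi τ) < X ^ (3 / 2 + 6 * τ) :=
        Real.rpow_lt_rpow_of_exponent_lt hX (by linarith)
      linarith
    have hSQQ : S = Q₀ * Q₁ := by rw [hS₁, hS₂, hS₂top, Ideal.mul_top]
    have hSQQJ : Q₀ * Q₁ ∣ J₀ := by rw [← hSQQ]; exact hSJ
    -- the two norms are distinct
    have hQ01 : Ideal.absNorm Q₀ ≠ Ideal.absNorm Q₁ := by
      intro hEq
      by_cases hQQ : Q₀ = Q₁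
      · apply hnsq
        refine ⟨Q₀, hQ₀p, hQ₀0, hQ₀pr, by rw [hQQ] at hSQQJ ⊢; exact hSQQJ, hQ₀half, ?_⟩
        by_contra hge
        push Not at hge
        have h1 : X ^ (1 - τ) * X ^ (1 - τ) ≤ (Ideal.absNorm S : ℝ) := by
          rw [hSQQ, map_mul, Nat.cast_mul, ← hQQ]
          exact mul_le_mul hge hge (Real.rpow_nonneg hX0.le _) (Nat.cast_nonneg _)
        have h2 : X ^ (1 - τ) * X ^ (1 - τ) = X ^ (2 - 2 * τ) := by rw [← Real.rpow_add hX0]; ring_nf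
        have h3 : X ^ (3 / 2 - τ - 2 * hbXi τ) < X ^ (2 - 2 * τ) :=
          Real.rpow_lt_rpow_of_exponent_lt hX (by linarith)
        linarith
      · exact hneq ⟨Q₀, Q₁, hQ₀p, hQ₀0, hQ₁p, hQ₁0, hQQ, hEq, hSQQJ, hQ₀half⟩
    -- the ordered version
    have key : ∀ Qa Qb : Ideal (𝓞 K), Qa.IsPrime → Qa ≠ ⊥ → (Ideal.absNorm Qa).Prime →
        Qb.IsPrime → Qb ≠ ⊥ → (Ideal.absNorm Qb).Prime →
        (Ideal.absNorm P₂ : ℝ) ≤ Ideal.absNorm Qb → X ^ (1 / 2 : ℝ) ≤ (Ideal.absNorm Qb : ℝ) →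
        Ideal.absNorm Qb < Ideal.absNorm Qa → S = Qa * Qb →
        ∃ y ∈ ((range (u2Bound τ + 1)).sigma (fun n => mIndexU2 τ n nn.2)).sigma
            (fun x => Fintype.piFinset fun j => Jprimes X τ (x.2 j)),
          P₁ * P₂ * ∏ j, y.2 j = J₀ := by
      intro Qa Qb hQap hQa0 hQapr hQbp hQb0 hQbpr hQbge hQbhalf hlt hSab
      have hNS : (Ideal.absNorm S : ℝ) = Ideal.absNorm Qa * Ideal.absNorm Qb := by
        rw [hSab, map_mul, Nat.cast_mul]
      have hQbpos : (0 : ℝ) < Ideal.absNorm Qb := by exact_mod_cast hQbpr.pos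
      have hQbhalf' : X ^ (1 / 2 + 2 * τ) ≤ (Ideal.absNorm Qb : ℝ) := hP2half.trans hQbge
      -- `N(Qa) < X^{1−τ}`
      have hQahi : (Ideal.absNorm Qa : ℝ) < X ^ (1 - τ) := by
        by_contra hge
        push Not at hge
        have h1 : X ^ (1 - τ) * X ^ (1 / 2 + 2 * τ) ≤ (Ideal.absNorm S : ℝ) := by
          rw [hNS]; exact mul_le_mul hge hQbhalf' (by positivity) (Nat.cast_nonneg _)
        have h2 : X ^ (1 - τ) * X ^ (1 / 2 + 2 * τ) = X ^ (3 / 2 + τ) := by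
          rw [← Real.rpow_add hX0]; ring_nf
        have h3 : X ^ (3 / 2 - τ - 2 * hbXi τ) < X ^ (3 / 2 + τ) :=
          Real.rpow_lt_rpow_of_exponent_lt hX (by linarith)
        linarith
      -- not close: `N(Qb)·X^ξ ≤ N(Qa)`
      have hfar : (Ideal.absNorm Qb : ℝ) * X ^ hbXi τ ≤ Ideal.absNorm Qa := by
        by_contra h
        push Not at h
        refine hnclose ⟨Qb, Qa, hQbp, hQb0, hQap, hQa0, hQbpr, hQapr, ?_, hQbhalf, hlt, h, hQahi⟩
        rw [mul_comm, ← hSab]; exact hSJ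
      -- boxes
      obtain ⟨ma, hma⟩ := exists_mem_Jprimes hX hτ hQap hQa0 hQapr
      obtain ⟨mb, hmb⟩ := exists_mem_Jprimes hX hτ hQbp hQb0 hQbpr
      obtain ⟨-, -, hloa, hhia, -⟩ := (mem_Jprimes_iff X τ).mp hma
      obtain ⟨-, -, hlob, hhib, -⟩ := (mem_Jprimes_iff X τ).mp hmb
      have emb : ((mb : ℝ) + 1) * hbXi τ < ((ma : ℝ) + 1) * hbXi τ := by
        refine exp_lt_of_rpow_le_of_lt hX ?_ hhia
        calc X ^ (((mb : ℝ) + 1) * hbXi τ) = X ^ ((mb : ℝ) * hbXi τ) * X ^ hbXi τ := by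
              rw [← Real.rpow_add hX0]; ring_nf
          _ ≤ Ideal.absNorm Qb * X ^ hbXi τ :=
              mul_le_mul_of_nonneg_right hlob (Real.rpow_nonneg hX0.le _)
          _ ≤ Ideal.absNorm Qa := hfar
      have hmbma : mb < ma := by
        have : (mb : ℝ) + 1 < ma + 1 := lt_of_mul_lt_mul_right emb hξ.le
        exact_mod_cast (by linarith : (mb : ℝ) < ma)
      have en2 : (nn.2 : ℝ) * hbXi τ < ((mb : ℝ) + 1) * hbXi τ :=
        exp_lt_of_rpow_le_of_lt hX (hlo2.trans hQbge) hhib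
      have hn2mb : nn.2 ≤ mb := by
        have : (nn.2 : ℝ) < mb + 1 := lt_of_mul_lt_mul_right en2 hξ.le
        exact_mod_cast Nat.lt_succ_iff.mp (by exact_mod_cast this)
      have e36 : 1 + 2 * τ < (((ma : ℝ) + 1) + ((mb : ℝ) + 1)) * hbXi τ := by
        refine exp_lt_of_rpow_le_of_lt hX hSlo.le ?_
        calc (Ideal.absNorm S : ℝ) = Ideal.absNorm Qa * Ideal.absNorm Qb := hNS
          _ < X ^ (((ma : ℝ) + 1) * hbXi τ) * X ^ (((mb : ℝ) + 1) * hbXi τ) :=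
              mul_lt_mul'' hhia hhib (Nat.cast_nonneg _) (Nat.cast_nonneg _)
          _ = X ^ ((((ma : ℝ) + 1) + ((mb : ℝ) + 1)) * hbXi τ) := by
              rw [← Real.rpow_add hX0]; ring_nf
      have e37 : ((ma : ℝ) + mb) * hbXi τ ≤ 3 / 2 - τ - 2 * hbXi τ := by
        refine exp_le_of_rpow_le_of_le hX ?_ hShi
        calc X ^ (((ma : ℝ) + mb) * hbXi τ) = X ^ ((ma : ℝ) * hbXi τ) * X ^ ((mb : ℝ) * hbXi τ) := by
              rw [← Real.rpow_add hX0]; ring_nf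
          _ ≤ Ideal.absNorm Qa * Ideal.absNorm Qb :=
              mul_le_mul hloa hlob (Real.rpow_nonneg hX0.le _) (Nat.cast_nonneg _)
          _ = Ideal.absNorm S := hNS.symm
      have hb : τ / hbXi τ ≤ (mb : ℝ) := h2lo.trans (by exact_mod_cast hn2mb)
      have ha : τ / hbXi τ ≤ (ma : ℝ) := hb.trans (by exact_mod_cast hmbma.le)
      have hadm : CoreAdmissible τ (![ma, mb] : Fin 2 → ℕ) := by
        refine ⟨StrictAnti.vecCons strictAnti_vecEmpty (show mb < ma from hmbma), ?_, ?_, ?_⟩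
        · rw [Fin.forall_fin_two]
          exact ⟨ha, hb⟩
        · rw [Fin.sum_univ_two, div_le_iff₀ hξ]
          show 1 + τ ≤ ((ma : ℝ) + (mb : ℝ)) * hbXi τ
          linarith
        · rw [Fin.sum_univ_two, le_div_iff₀ hξ]
          show ((ma : ℝ) + 1 + ((mb : ℝ) + 1)) * hbXi τ ≤ 3 / 2 - τ
          linarith
      have hmemM : (![ma, mb] : Fin 2 → ℕ) ∈ mIndexU2 τ 1 nn.2 :=
        (mem_mIndexU2_iff hτ).mpr ⟨hadm, show nn.2 ≤ mb from hn2mb⟩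
      have hmemQ : (![Qa, Qb] : Fin 2 → Ideal (𝓞 K)) ∈
          Fintype.piFinset (fun j => Jprimes X τ ((![ma, mb] : Fin 2 → ℕ) j)) :=
        Fintype.mem_piFinset.mpr (Fin.forall_fin_two.mpr ⟨hma, hmb⟩)
      refine ⟨⟨⟨1, ![ma, mb]⟩, ![Qa, Qb]⟩,
        mem_sigma.mpr ⟨mem_sigma.mpr ⟨mem_range.mpr hu2, hmemM⟩, hmemQ⟩, ?_⟩
      show R * ∏ j : Fin 2, (![Qa, Qb] : Fin 2 → Ideal (𝓞 K)) j = J₀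
      rw [Fin.prod_univ_two]
      show R * (Qa * Qb) = J₀
      rw [hS, hSab]
    rcases lt_or_gt_of_ne hQ01 with h | h
    · exact key Q₁ Q₀ hQ₁p hQ₁0 hQ₁pr hQ₀p hQ₀0 hQ₀pr hQ₀ge hQ₀half h (by rw [hSQQ, mul_comm])
    · exact key Q₀ Q₁ hQ₀p hQ₀0 hQ₀pr hQ₁p hQ₁0 hQ₁pr hQ₁ge hQ₁half h hSQQ

end Construction

section PerIndex

variable {ι : Type*} (E : Finset ι) (I : ι → Ideal (𝓞 K)) {X τ CN : ℝ}

open scoped Classical in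
/-- **The comparison at one hat index of `Û₂^{(1)}`.** For `((n₁,n₂), P₁, P₂)` and a family of
nonzero ideals with `X³ < N(I_i) ≤ C_N X³`: the exact count `S_K^≺(𝒵_{P₁P₂}, P₂)` and the weighted
hat count `∑_{(n,𝐦,(Q_j))} wt · #{i : P₁P₂∏Q_j = I_i}` differ by at most (i) `S_K(𝒵_{P₁P₂}, X^τ)` if
the index lies in the product window `N(P₁P₂) < C_N X^{3/2+τ+2ξ}`, (ii) twice the number of
`X^{1/2}`-rough members divisible by `P₁P₂` having one of the four defects (close pair, equal-norm
pair, prime factor of degree `≥ 2`, square factor), (iii) the weight error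
`((1 + μ^{-1})^{N+1} − 1)·S_K(𝒵_{P₁P₂}, X^τ)` (`1 ≤ μ ≤ τξ^{-1}`, `N = ⌊3/(2τ)⌋`) — the four error
sources of pp. 42–47 for `U₂^{(1)}` ("Here too we follow the same argument as used for `U^(n)`").
[cite: HeathBrownActa2001, §7 pp. 46–47] -/
theorem U2_per_index_le (hX : 1 < X) (hτ : 0 < τ) (hτ1 : τ ≤ 1 / 8)
    (hE : ∀ i ∈ E, I i ≠ ⊥ ∧ X ^ 3 < (Ideal.absNorm (I i) : ℝ) ∧ (Ideal.absNorm (I i) : ℝ) ≤ CN * X ^ 3)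
    {μ : ℕ} (hμ : 1 ≤ μ) (hμle : (μ : ℝ) ≤ τ / hbXi τ)
    {nn : ℕ × ℕ} (hnn : nn ∈ nPairs τ) {P₁ P₂ : Ideal (𝓞 K)} (hP₁ : P₁ ∈ Jprimes X τ nn.1)
    (hP₂ : P₂ ∈ Jprimes X τ nn.2) (FEAT : ι → Prop)
    (hFEAT : ∀ i ∈ E,
      ((∃ A B : Ideal (𝓞 K), A.IsPrime ∧ A ≠ ⊥ ∧ B.IsPrime ∧ B ≠ ⊥ ∧
          (Ideal.absNorm A).Prime ∧ (Ideal.absNorm B).Prime ∧ A * B ∣ I i ∧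
          X ^ (1 / 2 : ℝ) ≤ (Ideal.absNorm A : ℝ) ∧ Ideal.absNorm A < Ideal.absNorm B ∧
          (Ideal.absNorm B : ℝ) < Ideal.absNorm A * X ^ hbXi τ ∧
          (Ideal.absNorm B : ℝ) < X ^ (1 - τ)) ∨
       (∃ A B : Ideal (𝓞 K), A.IsPrime ∧ A ≠ ⊥ ∧ B.IsPrime ∧ B ≠ ⊥ ∧ A ≠ B ∧
          Ideal.absNorm A = Ideal.absNorm B ∧ A * B ∣ I i ∧
          X ^ (1 / 2 : ℝ) ≤ (Ideal.absNorm A : ℝ)) ∨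
       (∃ A : Ideal (𝓞 K), A.IsPrime ∧ A ≠ ⊥ ∧ ¬ (Ideal.absNorm A).Prime ∧ A ∣ I i ∧
          X ^ (1 / 2 : ℝ) ≤ (Ideal.absNorm A : ℝ)) ∨
       (∃ A : Ideal (𝓞 K), A.IsPrime ∧ A ≠ ⊥ ∧ (Ideal.absNorm A).Prime ∧ A * A ∣ I i ∧
          X ^ (1 / 2 : ℝ) ≤ (Ideal.absNorm A : ℝ) ∧ (Ideal.absNorm A : ℝ) < X ^ (1 - τ))) → FEAT i) :
    |(famSiftedAbove E I (P₁ * P₂) P₂ : ℝ) -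
        ∑ y ∈ ((range (u2Bound τ + 1)).sigma (fun n => mIndexU2 τ n nn.2)).sigma
            (fun x => Fintype.piFinset fun j => Jprimes X τ (x.2 j)),
          (∏ j, Real.log (Ideal.absNorm (y.2 j)) / ((y.1.2 j : ℝ) * hbXi τ * Real.log X)) *
            #{i ∈ E | P₁ * P₂ * ∏ j, y.2 j = I i}| ≤
      (if (Ideal.absNorm P₁ : ℝ) * Ideal.absNorm P₂ < CN * X ^ (3 / 2 + τ + 2 * hbXi τ) then
          (famSifted E I (P₁ * P₂) (X ^ τ) : ℝ) else 0) +
      2 * #{i ∈ E | P₁ * P₂ ∣ I i ∧ IsRough (X ^ (1 / 2 : ℝ)) (I i) ∧ FEAT i} +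
      ((1 + 1 / (μ : ℝ)) ^ (u2Bound τ + 1) - 1) * famSifted E I (P₁ * P₂) (X ^ τ) := by
  classical
  have hξ := hbXi_pos hτ
  have hX0 : 0 < X := by linarith
  obtain ⟨⟨hp1, hp10, hpr1, hlo1, hhi1⟩, ⟨hp2, hp20, hpr2, hlo2, hhi2⟩, hN21, hLT, hs1, hs2, hτ2, hhalf,
    hprodlo, hprodhi, -⟩ := U2_index_props hX hτ hτ1 hnn hP₁ hP₂
  have hhalfX : X ^ (1 / 2 : ℝ) ≤ X ^ ((nn.2 : ℝ) * hbXi τ) :=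
    le_trans (Real.rpow_le_rpow_of_exponent_le hX.le (by linarith)) hhalf
  set R := P₁ * P₂ with hR
  have hR0 : R ≠ ⊥ := mul_ne_zero hp10 hp20
  set NMQ := ((range (u2Bound τ + 1)).sigma (fun n => mIndexU2 τ n nn.2)).sigma
    (fun x => Fintype.piFinset fun j => Jprimes X τ (x.2 j)) with hNMQ
  set wt : (Σ x : (Σ _n : ℕ, Fin (_n + 1) → ℕ), Fin (x.1 + 1) → Ideal (𝓞 K)) → ℝ := fun y =>
    ∏ j, Real.log (Ideal.absNorm (y.2 j)) / ((y.1.2 j : ℝ) * hbXi τ * Real.log X) with hwt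
  set W : ℝ := (1 + 1 / (μ : ℝ)) ^ (u2Bound τ + 1) with hW
  set Ex := E.filter (fun i => R ∣ I i ∧ ∀ ⦃Q' : Ideal (𝓞 K)⦄, Q'.IsPrime → Q' ∣ I i → ¬ PrimeLT Q' P₂)
    with hEx
  set Ht := E.filter (fun i => ∃ y ∈ NMQ, R * ∏ j, y.2 j = I i) with hHt
  set Ft := E.filter (fun i => R ∣ I i ∧ IsRough (X ^ (1 / 2 : ℝ)) (I i) ∧ FEAT i) with hFt
  set Sf := E.filter (fun i => R ∣ I i ∧ IsRough (X ^ τ) (I i)) with hSf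
  have hSf_eq : (famSifted E I R (X ^ τ) : ℝ) = #Sf := by rw [famSifted]
  have hF_eq : (famSiftedAbove E I R P₂ : ℝ) = #Ex := by rw [famSiftedAbove]
  -- weights of hat tuples
  have hμ0 : (0 : ℝ) ≤ 1 / (μ : ℝ) := by positivity
  have hbase : (1 : ℝ) ≤ 1 + 1 / (μ : ℝ) := by linarith
  have hwt_bd : ∀ y ∈ NMQ, 1 ≤ wt y ∧ wt y ≤ W := by
    intro y hy
    have hy' := hy
    rw [hNMQ, mem_sigma, mem_sigma, mem_range] at hy'
    obtain ⟨⟨hn, hm⟩, hQ⟩ := hy'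
    obtain ⟨-, -, -, -, -, -, hμm⟩ := U2_tuple_props hX hτ hm hQ
    have hμm' : ∀ j, μ ≤ y.1.2 j := fun j => by exact_mod_cast hμle.trans (hμm j)
    have hb := tupleWt_bounds hX hτ hμ hμm' hQ
    exact ⟨hb.1, hb.2.trans (pow_le_pow_right₀ hbase (by omega))⟩
  have hW1 : 1 ≤ W := one_le_pow₀ hbase
  -- the hat sum as a sum over members
  set g : ι → ℝ := fun i => ∑ y ∈ NMQ, if R * ∏ j, y.2 j = I i then wt y else 0 with hg
  have hG : ∑ y ∈ NMQ, wt y * #{i ∈ E | R * ∏ j, y.2 j = I i} = ∑ i ∈ E, g i := by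
    simp only [hg]
    rw [sum_comm]
    refine sum_congr rfl fun y _ => ?_
    rw [← sum_filter, sum_const, nsmul_eq_mul, mul_comm]
  -- the value of `g` at a member
  have hg_mem : ∀ i ∈ Ht, 1 ≤ g i ∧ g i ≤ W := by
    intro i hi
    obtain ⟨hiE, y₀, hy₀, hy₀eq⟩ := mem_filter.mp hi
    have hval : g i = wt y₀ := by
      simp only [hg]
      rw [sum_eq_single_of_mem y₀ hy₀]
      · rw [if_pos hy₀eq]
      · intro y hy hne
        rw [if_neg]
        intro hyeq
        exact hne (U2_tuple_unique hX hτ hR0 hy hy₀ (hyeq.trans hy₀eq.symm))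
    rw [hval]; exact hwt_bd y₀ hy₀
  have hg_nmem : ∀ i ∈ E, i ∉ Ht → g i = 0 := by
    intro i hi hni
    simp only [hg]
    refine sum_eq_zero fun y hy => ?_
    rw [if_neg]
    intro hyeq
    exact hni (mem_filter.mpr ⟨hi, y, hy, hyeq⟩)
  have hHtE : Ht ⊆ E := filter_subset _ _
  have hGsplit : ∑ i ∈ E, g i = ∑ i ∈ Ht, g i := by
    rw [← sum_subset hHtE (fun i hi hni => hg_nmem i hi hni)]
  have hG_lo : (#Ht : ℝ) ≤ ∑ i ∈ E, g i := by
    rw [hGsplit]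
    calc (#Ht : ℝ) = ∑ _i ∈ Ht, (1 : ℝ) := by simp
      _ ≤ ∑ i ∈ Ht, g i := sum_le_sum fun i hi => (hg_mem i hi).1
  have hG_hi : ∑ i ∈ E, g i ≤ W * #Ht := by
    rw [hGsplit]
    calc ∑ i ∈ Ht, g i ≤ ∑ _i ∈ Ht, W := sum_le_sum fun i hi => (hg_mem i hi).2
      _ = W * #Ht := by rw [sum_const, nsmul_eq_mul, mul_comm]
  -- `Ht ⊆ Sf`
  have hHtSf : Ht ⊆ Sf := by
    intro i hi
    obtain ⟨hiE, y, hy, hyeq⟩ := mem_filter.mp hi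
    have hy' := hy
    rw [hNMQ, mem_sigma, mem_sigma, mem_range] at hy'
    obtain ⟨⟨-, hm⟩, hQ⟩ := hy'
    obtain ⟨hrough, -⟩ := U2_prod_isRough hX hτ hτ1 hnn hP₁ hP₂ hm hQ
    refine mem_filter.mpr ⟨hiE, ⟨∏ j, y.2 j, hyeq.symm⟩, ?_⟩
    rw [← hyeq]; exact hrough.mono hτ2
  have hHt_le : (#Ht : ℝ) ≤ #Sf := by exact_mod_cast card_le_card hHtSf
  -- `Ht ∖ Ex ⊆ Ft`
  have hHtEx : Ht \ Ex ⊆ Ft := by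
    intro i hi
    rw [Finset.mem_sdiff] at hi
    obtain ⟨hi, hni⟩ := hi
    obtain ⟨hiE, y, hy, hyeq⟩ := mem_filter.mp hi
    have hy' := hy
    rw [hNMQ, mem_sigma, mem_sigma, mem_range] at hy'
    obtain ⟨⟨-, hm⟩, hQ⟩ := hy'
    obtain ⟨hrough, -⟩ := U2_prod_isRough hX hτ hτ1 hnn hP₁ hP₂ hm hQ
    have hdvd : R ∣ I i := ⟨∏ j, y.2 j, hyeq.symm⟩
    have hex : ∃ Q' : Ideal (𝓞 K), Q'.IsPrime ∧ Q' ∣ I i ∧ PrimeLT Q' P₂ := by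
      by_contra hcon
      push Not at hcon
      exact hni (mem_filter.mpr ⟨hiE, hdvd, fun Q' hQ' hQ'd => hcon Q' hQ' hQ'd⟩)
    obtain ⟨Q', hQ'p, hQ'd, hQ'lt⟩ := hex
    rw [← hyeq] at hQ'd
    have hcases := U2_close_or_eq_of_primeLT hX hτ hτ1 hnn hP₁ hP₂ hm hQ hQ'p hQ'd hQ'lt
    refine mem_filter.mpr ⟨hiE, hdvd, by rw [← hyeq]; exact hrough.mono hhalfX, hFEAT i hiE ?_⟩
    rw [← hyeq]
    rcases hcases with h | h
    · exact Or.inl h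
    · exact Or.inr (Or.inl h)
  -- `Ex ∖ Ht`: inside the window all of `Sf`, outside it `⊆ Ft`
  have hExSf : Ex ⊆ Sf := by
    intro i hi
    obtain ⟨hiE, hdvd, habove⟩ := mem_filter.mp hi
    refine mem_filter.mpr ⟨hiE, hdvd, fun Q' hQ' hQ'd => ?_⟩
    rcases not_primeLT_iff.mp (habove hQ' hQ'd) with h | h
    · exact (hτ2.trans hlo2).trans (by exact_mod_cast h.absNorm_le)
    · rw [h]; exact hτ2.trans hlo2
  have hExHt : ¬ ((Ideal.absNorm P₁ : ℝ) * Ideal.absNorm P₂ < CN * X ^ (3 / 2 + τ + 2 * hbXi τ)) →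
      Ex \ Ht ⊆ Ft := by
    intro hwin i hi
    rw [Finset.mem_sdiff] at hi
    obtain ⟨hi, hni⟩ := hi
    obtain ⟨hiE, hdvd, habove⟩ := mem_filter.mp hi
    obtain ⟨hI0, hIlo, hIhi⟩ := hE i hiE
    have hrough : IsRough (X ^ (1 / 2 : ℝ)) (I i) := by
      intro Q' hQ' hQ'd
      rcases not_primeLT_iff.mp (habove hQ' hQ'd) with h | h
      · exact (hhalfX.trans hlo2).trans (by exact_mod_cast h.absNorm_le)
      · rw [h]; exact hhalfX.trans hlo2
    refine mem_filter.mpr ⟨hiE, hdvd, hrough, ?_⟩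
    by_contra hnf
    have hn := fun h => hnf (hFEAT i hiE h)
    obtain ⟨y, hy, hyeq⟩ := U2_exists_tuple hX hτ hτ1 hnn hP₁ hP₂ (not_lt.mp hwin) hIlo hIhi hdvd
      habove (fun h => hn (Or.inl h)) (fun h => hn (Or.inr (Or.inl h)))
      (fun h => hn (Or.inr (Or.inr (Or.inl h)))) (fun h => hn (Or.inr (Or.inr (Or.inr h))))
    exact hni (mem_filter.mpr ⟨hiE, y, hy, hyeq⟩)
  -- assemble
  have hcard := abs_card_sub_card_le Ex Ht
  have h1 : ((#(Ex \ Ht) : ℕ) : ℝ) ≤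
      (if (Ideal.absNorm P₁ : ℝ) * Ideal.absNorm P₂ < CN * X ^ (3 / 2 + τ + 2 * hbXi τ) then
          (famSifted E I R (X ^ τ) : ℝ) else 0) + #Ft := by
    split_ifs with hwin
    · have : Ex \ Ht ⊆ Sf := fun i hi => hExSf (mem_sdiff.mp hi).1
      have h := card_le_card this
      rw [hSf_eq]
      have : (0 : ℝ) ≤ #Ft := Nat.cast_nonneg _
      have h' : ((#(Ex \ Ht) : ℕ) : ℝ) ≤ #Sf := by exact_mod_cast h
      linarith
    · have h := card_le_card (hExHt hwin)
      have h' : ((#(Ex \ Ht) : ℕ) : ℝ) ≤ #Ft := by exact_mod_cast h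
      linarith
  have h2 : ((#(Ht \ Ex) : ℕ) : ℝ) ≤ #Ft := by exact_mod_cast card_le_card hHtEx
  have h3 : |(#Ht : ℝ) - ∑ i ∈ E, g i| ≤ (W - 1) * famSifted E I R (X ^ τ) := by
    rw [hSf_eq, abs_sub_le_iff]
    constructor
    · have : (0:ℝ) ≤ (W - 1) * #Sf := mul_nonneg (by linarith) (Nat.cast_nonneg _)
      linarith
    · have : W * (#Ht : ℝ) ≤ W * #Sf := mul_le_mul_of_nonneg_left hHt_le (by linarith)
      nlinarith
  rw [hG, hF_eq]
  calc |(#Ex : ℝ) - ∑ i ∈ E, g i| ≤ |(#Ex : ℝ) - #Ht| + |(#Ht : ℝ) - ∑ i ∈ E, g i| := abs_sub_le _ _ _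
    _ ≤ ((#(Ex \ Ht) : ℕ) + (#(Ht \ Ex) : ℕ)) + (W - 1) * famSifted E I R (X ^ τ) := add_le_add hcard h3
    _ ≤ _ := by linarith

open scoped Classical in
/-- **Bounded multiplicity of the hat indices at a rough member.** An `X^{1/2}`-rough member of
norm `≤ C_N X³ < X^{3+3τ}` has at most `6` prime ideal factors, so at most `36` hat indices
`((n₁,n₂), P₁, P₂)` have `P₁P₂ ∣ I_i` (the pair `(P₁, P₂)` determines `(n₁, n₂)`); hence for any
property `p` of members,
`∑_b #{i : P₁P₂ ∣ I_i, I_i rough, p(i)} ≤ 36 · #{i : I_i rough, p(i)}` — the counting device of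
p. 47 ("`#{P₂ : P₁P₂ ∈ 𝒜_{Q₁⋯Q_{n+1}}} ≤ S_K(𝒜_{Q₁⋯Q_{n+1}}, X^τ)`": count through the other factor).
[cite: HeathBrownActa2001, §7 p. 47] -/
theorem U2_sum_card_le_mul (hX : 1 < X) (hτ : 0 < τ) (hτ1 : τ ≤ 1 / 40) (hCN : CN < X ^ (3 * τ))
    (hE : ∀ i ∈ E, I i ≠ ⊥ ∧ X ^ 3 < (Ideal.absNorm (I i) : ℝ) ∧ (Ideal.absNorm (I i) : ℝ) ≤ CN * X ^ 3)
    (p : ι → Prop) :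
    ∑ b ∈ (nPairs τ).sigma (fun nn => Jprimes X τ nn.1 ×ˢ Jprimes X τ nn.2),
        (#{i ∈ E | b.2.1 * b.2.2 ∣ I i ∧ IsRough (X ^ (1 / 2 : ℝ)) (I i) ∧ p i} : ℝ) ≤
      36 * #{i ∈ E | IsRough (X ^ (1 / 2 : ℝ)) (I i) ∧ p i} := by
  classical
  set A := (nPairs τ).sigma (fun nn => Jprimes X τ nn.1 ×ˢ Jprimes X τ nn.2) with hA
  -- exchange the sums
  have hL : ∑ b ∈ A, (#{i ∈ E | b.2.1 * b.2.2 ∣ I i ∧ IsRough (X ^ (1 / 2 : ℝ)) (I i) ∧ p i} : ℝ) =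
      ∑ i ∈ E, ∑ b ∈ A, if b.2.1 * b.2.2 ∣ I i ∧ IsRough (X ^ (1 / 2 : ℝ)) (I i) ∧ p i then (1 : ℝ) else 0 := by
    rw [sum_comm]
    refine sum_congr rfl fun b _ => ?_
    rw [sum_boole]
  have hRHS : (36 : ℝ) * #{i ∈ E | IsRough (X ^ (1 / 2 : ℝ)) (I i) ∧ p i} =
      ∑ i ∈ E, if IsRough (X ^ (1 / 2 : ℝ)) (I i) ∧ p i then (36 : ℝ) else 0 := by
    rw [← sum_filter, sum_const, nsmul_eq_mul, mul_comm]
  rw [hL, hRHS]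
  refine sum_le_sum fun i hi => ?_
  obtain ⟨hI0, -, hIhi⟩ := hE i hi
  by_cases hp : IsRough (X ^ (1 / 2 : ℝ)) (I i) ∧ p i
  · rw [if_pos hp]
    have hsimp : ∀ b : (Σ _nn : ℕ × ℕ, Ideal (𝓞 K) × Ideal (𝓞 K)),
        (if b.2.1 * b.2.2 ∣ I i ∧ IsRough (X ^ (1 / 2 : ℝ)) (I i) ∧ p i then (1 : ℝ) else 0) =
          if b.2.1 * b.2.2 ∣ I i then 1 else 0 := by
      intro b
      by_cases h : b.2.1 * b.2.2 ∣ I i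
      · rw [if_pos ⟨h, hp⟩, if_pos h]
      · rw [if_neg (fun h' => h h'.1), if_neg h]
    rw [sum_congr rfl (fun b _ => hsimp b), sum_boole]
    -- the indices dividing `I i` inject into pairs of prime factors
    set pf := primeFactorsFinset (I i) with hpf
    have hpf6 : #pf ≤ 6 := by
      refine card_primeFactorsFinset_le_six hX hτ hτ1 hCN hI0 hIhi fun P hP => ?_
      obtain ⟨hPp, hPd⟩ := (mem_primeFactorsFinset_iff hI0).mp hP
      have h1 : X ^ (1 / 2 - 2 * τ) < X ^ (1 / 2 : ℝ) := Real.rpow_lt_rpow_of_exponent_lt hX (by linarith)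
      exact h1.trans_le (hp.1 hPp hPd)
    have hinj : Set.InjOn (fun b : (Σ _nn : ℕ × ℕ, Ideal (𝓞 K) × Ideal (𝓞 K)) => (b.2.1, b.2.2))
        (A.filter (fun b => b.2.1 * b.2.2 ∣ I i) : Set _) := by
      rintro ⟨nn, P₁, P₂⟩ hb ⟨nn', P₁', P₂'⟩ hb' h
      simp only [Prod.mk.injEq] at h
      obtain ⟨rfl, rfl⟩ := h
      simp only [coe_filter, Set.mem_setOf_eq, hA, mem_sigma, mem_product] at hb hb'
      have h1 : nn.1 = nn'.1 := Jprimes_index_unique hX hτ hb.1.2.1 hb'.1.2.1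
      have h2 : nn.2 = nn'.2 := Jprimes_index_unique hX hτ hb.1.2.2 hb'.1.2.2
      have : nn = nn' := Prod.ext h1 h2
      subst this
      rfl
    have hmaps : ∀ b ∈ A.filter (fun b => b.2.1 * b.2.2 ∣ I i),
        (fun b : (Σ _nn : ℕ × ℕ, Ideal (𝓞 K) × Ideal (𝓞 K)) => (b.2.1, b.2.2)) b ∈ pf ×ˢ pf := by
      intro b hb
      rw [mem_filter, hA, mem_sigma, mem_product] at hb
      obtain ⟨⟨-, hb1, hb2⟩, hdvd⟩ := hb
      obtain ⟨hq1, hq10, -⟩ := (mem_Jprimes_iff X τ).mp hb1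
      obtain ⟨hq2, hq20, -⟩ := (mem_Jprimes_iff X τ).mp hb2
      rw [mem_product]
      exact ⟨(mem_primeFactorsFinset_iff hI0).mpr ⟨hq1, (dvd_mul_right _ _).trans hdvd⟩,
        (mem_primeFactorsFinset_iff hI0).mpr ⟨hq2, (dvd_mul_left _ _).trans hdvd⟩⟩
    have hcard : #(A.filter (fun b => b.2.1 * b.2.2 ∣ I i)) ≤ 36 := by
      calc #(A.filter (fun b => b.2.1 * b.2.2 ∣ I i)) ≤ #(pf ×ˢ pf) := card_le_card_of_injOn _ hmaps hinj
        _ = #pf * #pf := card_product _ _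
        _ ≤ 6 * 6 := Nat.mul_le_mul hpf6 hpf6
    exact_mod_cast hcard
  · rw [if_neg hp]
    refine le_of_eq (sum_eq_zero fun b _ => ?_)
    rw [if_neg (fun h => hp h.2)]

end PerIndex

section Features

variable {ι : Type*} (E : Finset ι) (I : ι → Ideal (𝓞 K)) {X τ CN : ℝ}

open scoped Classical in
/-- **Members with a close pair of first-degree prime factors**: at most
`∑_{(Q,P) close} S_K(𝒵_{QP}, X^{1/2})` of the `X^{1/2}`-rough members have two first-degree prime
factors `X^{1/2} ≤ N(Q) < N(P) < N(Q)X^ξ`, `N(P) < X^{1−τ}` (each is counted at the ideal `QP`).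
[cite: HeathBrownActa2001, §7 pp. 44, 47] -/
theorem card_close_le :
    (#{i ∈ E | IsRough (X ^ (1 / 2 : ℝ)) (I i) ∧
        ∃ A B : Ideal (𝓞 K), A.IsPrime ∧ A ≠ ⊥ ∧ B.IsPrime ∧ B ≠ ⊥ ∧
          (Ideal.absNorm A).Prime ∧ (Ideal.absNorm B).Prime ∧ A * B ∣ I i ∧
          X ^ (1 / 2 : ℝ) ≤ (Ideal.absNorm A : ℝ) ∧ Ideal.absNorm A < Ideal.absNorm B ∧
          (Ideal.absNorm B : ℝ) < Ideal.absNorm A * X ^ hbXi τ ∧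
          (Ideal.absNorm B : ℝ) < X ^ (1 - τ)} : ℝ) ≤
      ∑ x ∈ (primesNormIco (X ^ (1 / 2 : ℝ)) (X ^ (1 - τ)) ×ˢ
          primesNormIco (X ^ (1 / 2 : ℝ)) (X ^ (1 - τ))).filter
          (fun x => (Ideal.absNorm x.1).Prime ∧ (Ideal.absNorm x.2).Prime ∧
            Ideal.absNorm x.1 < Ideal.absNorm x.2 ∧
            (Ideal.absNorm x.2 : ℝ) < Ideal.absNorm x.1 * X ^ hbXi τ),
        (famSifted E I (x.1 * x.2) (X ^ (1 / 2 : ℝ)) : ℝ) := by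
  classical
  set CP := (primesNormIco (X ^ (1 / 2 : ℝ)) (X ^ (1 - τ)) ×ˢ
      primesNormIco (X ^ (1 / 2 : ℝ)) (X ^ (1 - τ))).filter
      (fun x => (Ideal.absNorm x.1).Prime ∧ (Ideal.absNorm x.2).Prime ∧
        Ideal.absNorm x.1 < Ideal.absNorm x.2 ∧
        (Ideal.absNorm x.2 : ℝ) < Ideal.absNorm x.1 * X ^ hbXi τ) with hCP
  set S := E.filter (fun i => IsRough (X ^ (1 / 2 : ℝ)) (I i) ∧
      ∃ A B : Ideal (𝓞 K), A.IsPrime ∧ A ≠ ⊥ ∧ B.IsPrime ∧ B ≠ ⊥ ∧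
        (Ideal.absNorm A).Prime ∧ (Ideal.absNorm B).Prime ∧ A * B ∣ I i ∧
        X ^ (1 / 2 : ℝ) ≤ (Ideal.absNorm A : ℝ) ∧ Ideal.absNorm A < Ideal.absNorm B ∧
        (Ideal.absNorm B : ℝ) < Ideal.absNorm A * X ^ hbXi τ ∧
        (Ideal.absNorm B : ℝ) < X ^ (1 - τ)) with hS
  have hsub : S ⊆ CP.biUnion (fun x => E.filter (fun i => x.1 * x.2 ∣ I i ∧ IsRough (X ^ (1 / 2 : ℝ)) (I i))) := by
    intro i hi
    obtain ⟨hiE, hrough, A, B, hA, hA0, hB, hB0, hAp, hBp, hdvd, hAlo, hAB, hclose, hBhi⟩ := mem_filter.mp hi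
    rw [mem_biUnion]
    refine ⟨(A, B), ?_, mem_filter.mpr ⟨hiE, hdvd, hrough⟩⟩
    rw [hCP, mem_filter, mem_product, mem_primesNormIco_iff, mem_primesNormIco_iff]
    have hAB' : (Ideal.absNorm A : ℝ) < Ideal.absNorm B := by exact_mod_cast hAB
    exact ⟨⟨⟨hA, hA0, hAlo, hAB'.trans hBhi⟩, ⟨hB, hB0, hAlo.trans hAB'.le, hBhi⟩⟩, hAp, hBp, hAB, hclose⟩
  calc (#S : ℝ) ≤ #(CP.biUnion (fun x => E.filter (fun i => x.1 * x.2 ∣ I i ∧ IsRough (X ^ (1 / 2 : ℝ)) (I i)))) := by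
        exact_mod_cast card_le_card hsub
    _ ≤ ∑ x ∈ CP, (#(E.filter (fun i => x.1 * x.2 ∣ I i ∧ IsRough (X ^ (1 / 2 : ℝ)) (I i))) : ℝ) := by
        exact_mod_cast card_biUnion_le
    _ = _ := by simp only [famSifted]

open scoped Classical in
/-- **Members with two distinct prime factors of equal norm `≥ X^{1/2}`**: at most
`∑_{Q ≠ Q', N(Q) = N(Q')} #𝒵_{QQ'}` (norms `≤ N(I_i) ≤ C_N X³`). [cite: HeathBrownActa2001, §7 p. 46] -/
theorem card_eqNorm_le
    (hE : ∀ i ∈ E, I i ≠ ⊥ ∧ X ^ 3 < (Ideal.absNorm (I i) : ℝ) ∧ (Ideal.absNorm (I i) : ℝ) ≤ CN * X ^ 3) :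
    (#{i ∈ E | IsRough (X ^ (1 / 2 : ℝ)) (I i) ∧
        ∃ A B : Ideal (𝓞 K), A.IsPrime ∧ A ≠ ⊥ ∧ B.IsPrime ∧ B ≠ ⊥ ∧ A ≠ B ∧
          Ideal.absNorm A = Ideal.absNorm B ∧ A * B ∣ I i ∧
          X ^ (1 / 2 : ℝ) ≤ (Ideal.absNorm A : ℝ)} : ℝ) ≤
      ∑ x ∈ (primesNormIco (X ^ (1 / 2 : ℝ)) (CN * X ^ 3 + 1) ×ˢ
          primesNormIco (X ^ (1 / 2 : ℝ)) (CN * X ^ 3 + 1)).filter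
          (fun x => x.1 ≠ x.2 ∧ Ideal.absNorm x.1 = Ideal.absNorm x.2),
        (famCount E I (x.1 * x.2) : ℝ) := by
  classical
  set CP := (primesNormIco (X ^ (1 / 2 : ℝ)) (CN * X ^ 3 + 1) ×ˢ
      primesNormIco (X ^ (1 / 2 : ℝ)) (CN * X ^ 3 + 1)).filter
      (fun x => x.1 ≠ x.2 ∧ Ideal.absNorm x.1 = Ideal.absNorm x.2) with hCP
  set S := E.filter (fun i => IsRough (X ^ (1 / 2 : ℝ)) (I i) ∧
      ∃ A B : Ideal (𝓞 K), A.IsPrime ∧ A ≠ ⊥ ∧ B.IsPrime ∧ B ≠ ⊥ ∧ A ≠ B ∧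
        Ideal.absNorm A = Ideal.absNorm B ∧ A * B ∣ I i ∧
        X ^ (1 / 2 : ℝ) ≤ (Ideal.absNorm A : ℝ)) with hS
  have hsub : S ⊆ CP.biUnion (fun x => E.filter (fun i => x.1 * x.2 ∣ I i)) := by
    intro i hi
    obtain ⟨hiE, -, A, B, hA, hA0, hB, hB0, hAB, hN, hdvd, hAlo⟩ := mem_filter.mp hi
    obtain ⟨hI0, -, hIhi⟩ := hE i hiE
    have hNI : 0 < Ideal.absNorm (I i) := Nat.pos_of_ne_zero fun h => hI0 (Ideal.absNorm_eq_zero_iff.mp h)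
    have hAle : (Ideal.absNorm A : ℝ) ≤ Ideal.absNorm (I i) := by
      exact_mod_cast Nat.le_of_dvd hNI (Ideal.absNorm_dvd_absNorm_of_le (Ideal.le_of_dvd ((dvd_mul_right A B).trans hdvd)))
    have hAhi : (Ideal.absNorm A : ℝ) < CN * X ^ 3 + 1 := by linarith
    rw [mem_biUnion]
    refine ⟨(A, B), ?_, mem_filter.mpr ⟨hiE, hdvd⟩⟩
    rw [hCP, mem_filter, mem_product, mem_primesNormIco_iff, mem_primesNormIco_iff]
    have hNr : (Ideal.absNorm B : ℝ) = Ideal.absNorm A := by exact_mod_cast hN.symm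
    exact ⟨⟨⟨hA, hA0, hAlo, hAhi⟩, ⟨hB, hB0, by rw [hNr]; exact hAlo, by rw [hNr]; exact hAhi⟩⟩, hAB, hN⟩
  calc (#S : ℝ) ≤ #(CP.biUnion (fun x => E.filter (fun i => x.1 * x.2 ∣ I i))) := by
        exact_mod_cast card_le_card hsub
    _ ≤ ∑ x ∈ CP, (#(E.filter (fun i => x.1 * x.2 ∣ I i)) : ℝ) := by exact_mod_cast card_biUnion_le
    _ = _ := by simp only [famCount]

open scoped Classical in
/-- **Members with a prime factor of degree `≥ 2` and norm `≥ X^{1/2}`**: at most `∑_Q #𝒵_Q` over such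
primes `Q` of norm `≤ C_N X³`. [cite: HeathBrownActa2001, §7 pp. 45–46] -/
theorem card_degTwo_le
    (hE : ∀ i ∈ E, I i ≠ ⊥ ∧ X ^ 3 < (Ideal.absNorm (I i) : ℝ) ∧ (Ideal.absNorm (I i) : ℝ) ≤ CN * X ^ 3) :
    (#{i ∈ E | IsRough (X ^ (1 / 2 : ℝ)) (I i) ∧
        ∃ A : Ideal (𝓞 K), A.IsPrime ∧ A ≠ ⊥ ∧ ¬ (Ideal.absNorm A).Prime ∧ A ∣ I i ∧
          X ^ (1 / 2 : ℝ) ≤ (Ideal.absNorm A : ℝ)} : ℝ) ≤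
      ∑ Q ∈ (primesNormIco (X ^ (1 / 2 : ℝ)) (CN * X ^ 3 + 1)).filter
          (fun Q => ¬ (Ideal.absNorm Q).Prime), (famCount E I Q : ℝ) := by
  classical
  set CP := (primesNormIco (X ^ (1 / 2 : ℝ)) (CN * X ^ 3 + 1)).filter
      (fun Q => ¬ (Ideal.absNorm Q).Prime) with hCP
  set S := E.filter (fun i => IsRough (X ^ (1 / 2 : ℝ)) (I i) ∧
      ∃ A : Ideal (𝓞 K), A.IsPrime ∧ A ≠ ⊥ ∧ ¬ (Ideal.absNorm A).Prime ∧ A ∣ I i ∧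
        X ^ (1 / 2 : ℝ) ≤ (Ideal.absNorm A : ℝ)) with hS
  have hsub : S ⊆ CP.biUnion (fun Q => E.filter (fun i => Q ∣ I i)) := by
    intro i hi
    obtain ⟨hiE, -, A, hA, hA0, hAp, hdvd, hAlo⟩ := mem_filter.mp hi
    obtain ⟨hI0, -, hIhi⟩ := hE i hiE
    have hNI : 0 < Ideal.absNorm (I i) := Nat.pos_of_ne_zero fun h => hI0 (Ideal.absNorm_eq_zero_iff.mp h)
    have hAle : (Ideal.absNorm A : ℝ) ≤ Ideal.absNorm (I i) := by
      exact_mod_cast Nat.le_of_dvd hNI (Ideal.absNorm_dvd_absNorm_of_le (Ideal.le_of_dvd hdvd))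
    rw [mem_biUnion]
    refine ⟨A, ?_, mem_filter.mpr ⟨hiE, hdvd⟩⟩
    rw [hCP, mem_filter, mem_primesNormIco_iff]
    exact ⟨⟨hA, hA0, hAlo, by linarith⟩, hAp⟩
  calc (#S : ℝ) ≤ #(CP.biUnion (fun Q => E.filter (fun i => Q ∣ I i))) := by
        exact_mod_cast card_le_card hsub
    _ ≤ ∑ Q ∈ CP, (#(E.filter (fun i => Q ∣ I i)) : ℝ) := by exact_mod_cast card_biUnion_le
    _ = _ := by simp only [famCount]

open scoped Classical in
/-- **Members with a square factor `Q²`, `Q` first degree, `X^{1/2} ≤ N(Q) < X^{1−τ}`**: at most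
`∑_Q #𝒵_{Q²}`. [cite: HeathBrownActa2001, §7 (7.5)–(7.6)] -/
theorem card_sq_le :
    (#{i ∈ E | IsRough (X ^ (1 / 2 : ℝ)) (I i) ∧
        ∃ A : Ideal (𝓞 K), A.IsPrime ∧ A ≠ ⊥ ∧ (Ideal.absNorm A).Prime ∧ A * A ∣ I i ∧
          X ^ (1 / 2 : ℝ) ≤ (Ideal.absNorm A : ℝ) ∧ (Ideal.absNorm A : ℝ) < X ^ (1 - τ)} : ℝ) ≤
      ∑ Q ∈ (primesNormIco (X ^ (1 / 2 : ℝ)) (X ^ (1 - τ))).filter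
          (fun Q => (Ideal.absNorm Q).Prime), (famCount E I (Q * Q) : ℝ) := by
  classical
  set CP := (primesNormIco (X ^ (1 / 2 : ℝ)) (X ^ (1 - τ))).filter
      (fun Q => (Ideal.absNorm Q).Prime) with hCP
  set S := E.filter (fun i => IsRough (X ^ (1 / 2 : ℝ)) (I i) ∧
      ∃ A : Ideal (𝓞 K), A.IsPrime ∧ A ≠ ⊥ ∧ (Ideal.absNorm A).Prime ∧ A * A ∣ I i ∧
        X ^ (1 / 2 : ℝ) ≤ (Ideal.absNorm A : ℝ) ∧ (Ideal.absNorm A : ℝ) < X ^ (1 - τ)) with hS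
  have hsub : S ⊆ CP.biUnion (fun Q => E.filter (fun i => Q * Q ∣ I i)) := by
    intro i hi
    obtain ⟨hiE, -, A, hA, hA0, hAp, hdvd, hAlo, hAhi⟩ := mem_filter.mp hi
    rw [mem_biUnion]
    refine ⟨A, ?_, mem_filter.mpr ⟨hiE, hdvd⟩⟩
    rw [hCP, mem_filter, mem_primesNormIco_iff]
    exact ⟨⟨hA, hA0, hAlo, hAhi⟩, hAp⟩
  calc (#S : ℝ) ≤ #(CP.biUnion (fun Q => E.filter (fun i => Q * Q ∣ I i))) := by
        exact_mod_cast card_le_card hsub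
    _ ≤ ∑ Q ∈ CP, (#(E.filter (fun i => Q * Q ∣ I i)) : ℝ) := by exact_mod_cast card_biUnion_le
    _ = _ := by simp only [famCount]

open scoped Classical in
/-- The four defects together. [folklore] -/
theorem card_feat_le
    (hE : ∀ i ∈ E, I i ≠ ⊥ ∧ X ^ 3 < (Ideal.absNorm (I i) : ℝ) ∧ (Ideal.absNorm (I i) : ℝ) ≤ CN * X ^ 3) :
    (#{i ∈ E | IsRough (X ^ (1 / 2 : ℝ)) (I i) ∧
        ((∃ A B : Ideal (𝓞 K), A.IsPrime ∧ A ≠ ⊥ ∧ B.IsPrime ∧ B ≠ ⊥ ∧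
            (Ideal.absNorm A).Prime ∧ (Ideal.absNorm B).Prime ∧ A * B ∣ I i ∧
            X ^ (1 / 2 : ℝ) ≤ (Ideal.absNorm A : ℝ) ∧ Ideal.absNorm A < Ideal.absNorm B ∧
            (Ideal.absNorm B : ℝ) < Ideal.absNorm A * X ^ hbXi τ ∧
            (Ideal.absNorm B : ℝ) < X ^ (1 - τ)) ∨
         (∃ A B : Ideal (𝓞 K), A.IsPrime ∧ A ≠ ⊥ ∧ B.IsPrime ∧ B ≠ ⊥ ∧ A ≠ B ∧
            Ideal.absNorm A = Ideal.absNorm B ∧ A * B ∣ I i ∧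
            X ^ (1 / 2 : ℝ) ≤ (Ideal.absNorm A : ℝ)) ∨
         (∃ A : Ideal (𝓞 K), A.IsPrime ∧ A ≠ ⊥ ∧ ¬ (Ideal.absNorm A).Prime ∧ A ∣ I i ∧
            X ^ (1 / 2 : ℝ) ≤ (Ideal.absNorm A : ℝ)) ∨
         (∃ A : Ideal (𝓞 K), A.IsPrime ∧ A ≠ ⊥ ∧ (Ideal.absNorm A).Prime ∧ A * A ∣ I i ∧
            X ^ (1 / 2 : ℝ) ≤ (Ideal.absNorm A : ℝ) ∧ (Ideal.absNorm A : ℝ) < X ^ (1 - τ)))} : ℝ) ≤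
      ∑ x ∈ (primesNormIco (X ^ (1 / 2 : ℝ)) (X ^ (1 - τ)) ×ˢ
          primesNormIco (X ^ (1 / 2 : ℝ)) (X ^ (1 - τ))).filter
          (fun x => (Ideal.absNorm x.1).Prime ∧ (Ideal.absNorm x.2).Prime ∧
            Ideal.absNorm x.1 < Ideal.absNorm x.2 ∧
            (Ideal.absNorm x.2 : ℝ) < Ideal.absNorm x.1 * X ^ hbXi τ),
        (famSifted E I (x.1 * x.2) (X ^ (1 / 2 : ℝ)) : ℝ) +
      ∑ x ∈ (primesNormIco (X ^ (1 / 2 : ℝ)) (CN * X ^ 3 + 1) ×ˢ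
          primesNormIco (X ^ (1 / 2 : ℝ)) (CN * X ^ 3 + 1)).filter
          (fun x => x.1 ≠ x.2 ∧ Ideal.absNorm x.1 = Ideal.absNorm x.2),
        (famCount E I (x.1 * x.2) : ℝ) +
      ∑ Q ∈ (primesNormIco (X ^ (1 / 2 : ℝ)) (CN * X ^ 3 + 1)).filter
          (fun Q => ¬ (Ideal.absNorm Q).Prime), (famCount E I Q : ℝ) +
      ∑ Q ∈ (primesNormIco (X ^ (1 / 2 : ℝ)) (X ^ (1 - τ))).filter
          (fun Q => (Ideal.absNorm Q).Prime), (famCount E I (Q * Q) : ℝ) := by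
  classical
  have h1 := card_close_le E I (X := X) (τ := τ)
  have h2 := card_eqNorm_le E I hE
  have h3 := card_degTwo_le E I hE
  have h4 := card_sq_le E I (X := X) (τ := τ)
  -- split the disjunction
  set r : ι → Prop := fun i => IsRough (X ^ (1 / 2 : ℝ)) (I i) with hr
  set pa : ι → Prop := fun i => ∃ A B : Ideal (𝓞 K), A.IsPrime ∧ A ≠ ⊥ ∧ B.IsPrime ∧ B ≠ ⊥ ∧
      (Ideal.absNorm A).Prime ∧ (Ideal.absNorm B).Prime ∧ A * B ∣ I i ∧
      X ^ (1 / 2 : ℝ) ≤ (Ideal.absNorm A : ℝ) ∧ Ideal.absNorm A < Ideal.absNorm B ∧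
      (Ideal.absNorm B : ℝ) < Ideal.absNorm A * X ^ hbXi τ ∧
      (Ideal.absNorm B : ℝ) < X ^ (1 - τ) with hpa
  set pb : ι → Prop := fun i => ∃ A B : Ideal (𝓞 K), A.IsPrime ∧ A ≠ ⊥ ∧ B.IsPrime ∧ B ≠ ⊥ ∧ A ≠ B ∧
      Ideal.absNorm A = Ideal.absNorm B ∧ A * B ∣ I i ∧
      X ^ (1 / 2 : ℝ) ≤ (Ideal.absNorm A : ℝ) with hpb
  set pc : ι → Prop := fun i => ∃ A : Ideal (𝓞 K), A.IsPrime ∧ A ≠ ⊥ ∧ ¬ (Ideal.absNorm A).Prime ∧ A ∣ I i ∧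
      X ^ (1 / 2 : ℝ) ≤ (Ideal.absNorm A : ℝ) with hpc
  set pd : ι → Prop := fun i => ∃ A : Ideal (𝓞 K), A.IsPrime ∧ A ≠ ⊥ ∧ (Ideal.absNorm A).Prime ∧ A * A ∣ I i ∧
      X ^ (1 / 2 : ℝ) ≤ (Ideal.absNorm A : ℝ) ∧ (Ideal.absNorm A : ℝ) < X ^ (1 - τ) with hpd
  have hsub : E.filter (fun i => r i ∧ (pa i ∨ pb i ∨ pc i ∨ pd i)) ⊆
      E.filter (fun i => r i ∧ pa i) ∪ E.filter (fun i => r i ∧ pb i) ∪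
        E.filter (fun i => r i ∧ pc i) ∪ E.filter (fun i => r i ∧ pd i) := by
    intro i hi
    obtain ⟨hiE, hri, h⟩ := mem_filter.mp hi
    simp only [mem_union, mem_filter]
    rcases h with h | h | h | h
    · exact Or.inl (Or.inl (Or.inl ⟨hiE, hri, h⟩))
    · exact Or.inl (Or.inl (Or.inr ⟨hiE, hri, h⟩))
    · exact Or.inl (Or.inr ⟨hiE, hri, h⟩)
    · exact Or.inr ⟨hiE, hri, h⟩
  have hcard := card_le_card hsub
  set SA := E.filter (fun i => r i ∧ pa i) with hSA
  set SB := E.filter (fun i => r i ∧ pb i) with hSB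
  set SC := E.filter (fun i => r i ∧ pc i) with hSC
  set SD := E.filter (fun i => r i ∧ pd i) with hSD
  have hu : #(SA ∪ SB ∪ SC ∪ SD) ≤ #SA + #SB + #SC + #SD := by
    calc #(SA ∪ SB ∪ SC ∪ SD) ≤ #(SA ∪ SB ∪ SC) + #SD := card_union_le _ _
      _ ≤ #(SA ∪ SB) + #SC + #SD := Nat.add_le_add_right (card_union_le _ _) _
      _ ≤ #SA + #SB + #SC + #SD := Nat.add_le_add_right (Nat.add_le_add_right (card_union_le _ _) _) _
  have h := hcard.trans hu
  have h' : ((#(E.filter (fun i => r i ∧ (pa i ∨ pb i ∨ pc i ∨ pd i))) : ℕ) : ℝ) ≤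
      (#SA : ℕ) + (#SB : ℕ) + (#SC : ℕ) + (#SD : ℕ) := by
    exact_mod_cast h
  exact h'.trans (add_le_add (add_le_add (add_le_add h1 h2) h3) h4)

end Features

section Generic

variable {X τ CN : ℝ}

/-- A pair `({P₁}, P₂)` of first-degree primes with distinct norms is a good index. [folklore] -/
theorem UGood_pair {P₁ P₂ : Ideal (𝓞 K)} (hpr1 : (Ideal.absNorm P₁).Prime)
    (hpr2 : (Ideal.absNorm P₂).Prime) (hne : Ideal.absNorm P₂ ≠ Ideal.absNorm P₁) :
    UGood ((({P₁} : Finset (Ideal (𝓞 K))), P₂) : Finset (Ideal (𝓞 K)) × Ideal (𝓞 K)) := by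
  classical
  constructor
  · intro P hP
    simp only [mem_insert, mem_singleton] at hP
    rcases hP with rfl | rfl
    · exact hpr2
    · exact hpr1
  · intro x hx y hy hxy
    simp only [coe_insert, coe_singleton, Set.mem_insert_iff, Set.mem_singleton_iff] at hx hy
    rcases hx with rfl | rfl <;> rcases hy with rfl | rfl
    · rfl
    · exact absurd hxy hne
    · exact absurd hxy.symm hne
    · rfl

/-- `uIdeal ({P₁}, P₂) = P₁P₂`. [folklore] -/
theorem uIdeal_pair (P₁ P₂ : Ideal (𝓞 K)) :
    uIdeal ((({P₁} : Finset (Ideal (𝓞 K))), P₂) : Finset (Ideal (𝓞 K)) × Ideal (𝓞 K)) = P₁ * P₂ := by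
  rw [uIdeal, prod_singleton]

open scoped Classical in
/-- **The unmatched good indices of `U₂^{(1)}` lie in the edge/close classes.** A good index
`({P₁}, P₂)` of `U₂^{(1)}` (`N(P₁P₂) ≥ X^{3/2+τ}`) which is not `φ` of a hat index
`((n₁,n₂), P₁, P₂)` has a member of norm `< X^{τ+ξ}`, or one of norm `≥ X^{1−τ−ξ}`, or its two
norms within a factor `X^ξ`, or `N(P₁P₂) < C_N X^{3/2+τ+2ξ}` (`C_N ≥ 1`): otherwise the boxes
`n_j` with `P_j ∈ 𝒥(n_j)` satisfy the constraints of `nPairs` (pp. 16–17, read as interval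
conditions exactly as for `Û^{(n)}`, p. 43). [cite: HeathBrownActa2001, §7 pp. 43, 46–47] -/
theorem U2_unmatched_cases (hX : 1 < X) (hτ : 0 < τ) (hCN1 : 1 ≤ CN)
    {t : Finset (Ideal (𝓞 K)) × Ideal (𝓞 K)}
    (ht : t ∈ (Upairs X τ 1).filter
      (fun t => X ^ (3 / 2 + τ) ≤ ((Ideal.absNorm (∏ P ∈ t.1, P) * Ideal.absNorm t.2 : ℕ) : ℝ)))
    (hg : UGood t)
    (hun : t ∉ ((nPairs τ).sigma (fun nn => Jprimes X τ nn.1 ×ˢ Jprimes X τ nn.2)).image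
        (fun b : (Σ _nn : ℕ × ℕ, Ideal (𝓞 K) × Ideal (𝓞 K)) =>
          (((({b.2.1} : Finset (Ideal (𝓞 K))), b.2.2)) : Finset (Ideal (𝓞 K)) × Ideal (𝓞 K)))) :
    (∃ Q ∈ insert t.2 t.1, (Ideal.absNorm Q : ℝ) < X ^ (τ + hbXi τ)) ∨
    (∃ Q ∈ insert t.2 t.1, X ^ (1 - τ - hbXi τ) ≤ (Ideal.absNorm Q : ℝ)) ∨
    (∃ Q ∈ insert t.2 t.1, ∃ Q' ∈ insert t.2 t.1, Ideal.absNorm Q < Ideal.absNorm Q' ∧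
        (Ideal.absNorm Q' : ℝ) < Ideal.absNorm Q * X ^ hbXi τ) ∨
    ((Ideal.absNorm (uIdeal t) : ℝ) < CN * X ^ (3 / 2 + τ + 2 * hbXi τ)) := by
  classical
  have hξ := hbXi_pos hτ
  have hX0 : 0 < X := by linarith
  obtain ⟨htU, -⟩ := mem_filter.mp ht
  obtain ⟨hchain, hsmall2, hlt2, -⟩ := mem_Upairs_iff.mp htU
  obtain ⟨hsub, hcard, -⟩ := mem_chains_iff.mp hchain
  obtain ⟨P₁, hP₁eq⟩ := card_eq_one.mp hcard
  have hP₁mem : P₁ ∈ t.1 := by rw [hP₁eq]; exact mem_singleton_self _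
  have hs1 := mem_smallPrimes_iff.mp (hsub hP₁mem)
  have hs2 := mem_smallPrimes_iff.mp hsmall2
  have hLT : PrimeLT t.2 P₁ := hlt2 P₁ hP₁mem
  have hpr1 : (Ideal.absNorm P₁).Prime := hg.1 P₁ (mem_insert_of_mem hP₁mem)
  have hpr2 : (Ideal.absNorm t.2).Prime := hg.1 t.2 (mem_insert_self _ _)
  have hne : t.2 ≠ P₁ := hLT.ne
  have hNne : Ideal.absNorm t.2 ≠ Ideal.absNorm P₁ := fun h =>
    hne (hg.2 (mem_insert_self _ _) (mem_insert_of_mem hP₁mem) h)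
  have hN21 : Ideal.absNorm t.2 < Ideal.absNorm P₁ := (primeLT_iff_absNorm_lt_of_ne hNne).mp hLT
  obtain ⟨n₁, hn₁⟩ := exists_mem_Jprimes hX hτ hs1.1 hs1.2.1 hpr1
  obtain ⟨n₂, hn₂⟩ := exists_mem_Jprimes hX hτ hs2.1 hs2.2.1 hpr2
  obtain ⟨-, -, hlo1, hhi1, -⟩ := (mem_Jprimes_iff X τ).mp hn₁
  obtain ⟨-, -, hlo2, hhi2, -⟩ := (mem_Jprimes_iff X τ).mp hn₂
  by_contra hcon
  push Not at hcon
  obtain ⟨hA, hB, hC, hD⟩ := hcon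
  -- (α) `τ/ξ ≤ n₂`
  have e2 : τ / hbXi τ ≤ (n₂ : ℝ) := by
    have h1 : τ + hbXi τ < ((n₂ : ℝ) + 1) * hbXi τ :=
      exp_lt_of_rpow_le_of_lt hX (hA t.2 (mem_insert_self _ _)) hhi2
    rw [div_le_iff₀ hξ]; nlinarith
  -- (β) `n₂ < n₁`
  have e21 : n₂ < n₁ := by
    have hfar := hC t.2 (mem_insert_self _ _) P₁ (mem_insert_of_mem hP₁mem) hN21
    have h1 : ((n₂ : ℝ) + 1) * hbXi τ < ((n₁ : ℝ) + 1) * hbXi τ := by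
      refine exp_lt_of_rpow_le_of_lt hX ?_ hhi1
      calc X ^ (((n₂ : ℝ) + 1) * hbXi τ) = X ^ ((n₂ : ℝ) * hbXi τ) * X ^ hbXi τ := by
            rw [← Real.rpow_add hX0]; ring_nf
        _ ≤ Ideal.absNorm t.2 * X ^ hbXi τ := mul_le_mul_of_nonneg_right hlo2 (Real.rpow_nonneg hX0.le _)
        _ ≤ Ideal.absNorm P₁ := hfar
    have : (n₂ : ℝ) + 1 < n₁ + 1 := lt_of_mul_lt_mul_right h1 hξ.le
    exact_mod_cast (by linarith : (n₂ : ℝ) < n₁)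
  -- (γ) `n₁ ≤ (1−τ)/ξ − 1`
  have e1 : (n₁ : ℝ) ≤ (1 - τ) / hbXi τ - 1 := by
    have h1 : (n₁ : ℝ) * hbXi τ < 1 - τ - hbXi τ :=
      exp_lt_of_rpow_le_of_lt hX hlo1 (hB P₁ (mem_insert_of_mem hP₁mem))
    rw [le_sub_iff_add_le, le_div_iff₀ hξ]; nlinarith
  -- (δ) `(3/2+τ)/ξ ≤ n₁ + n₂`
  have esum : (3 / 2 + τ) / hbXi τ ≤ (n₁ : ℝ) + n₂ := by
    have hN : (Ideal.absNorm (uIdeal t) : ℝ) = Ideal.absNorm P₁ * Ideal.absNorm t.2 := by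
      rw [absNorm_uIdeal, hP₁eq, prod_singleton, Nat.cast_mul]
    have h1 : 3 / 2 + τ + 2 * hbXi τ < ((n₁ : ℝ) + 1 + ((n₂ : ℝ) + 1)) * hbXi τ := by
      refine exp_lt_of_rpow_le_of_lt hX ?_ (?_ : (Ideal.absNorm (uIdeal t) : ℝ) < _)
      · calc X ^ (3 / 2 + τ + 2 * hbXi τ) = 1 * X ^ (3 / 2 + τ + 2 * hbXi τ) := (one_mul _).symm
          _ ≤ CN * X ^ (3 / 2 + τ + 2 * hbXi τ) :=
              mul_le_mul_of_nonneg_right hCN1 (Real.rpow_nonneg hX0.le _)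
          _ ≤ Ideal.absNorm (uIdeal t) := hD
      · rw [hN]
        calc (Ideal.absNorm P₁ : ℝ) * Ideal.absNorm t.2 <
            X ^ (((n₁ : ℝ) + 1) * hbXi τ) * X ^ (((n₂ : ℝ) + 1) * hbXi τ) :=
              mul_lt_mul'' hhi1 hhi2 (Nat.cast_nonneg _) (Nat.cast_nonneg _)
          _ = X ^ (((n₁ : ℝ) + 1 + ((n₂ : ℝ) + 1)) * hbXi τ) := by rw [← Real.rpow_add hX0]; ring_nf
    rw [div_le_iff₀ hξ]; nlinarith
  -- (ε) the box bound
  have hmB : ∀ {n : ℕ} {P : Ideal (𝓞 K)}, X ^ ((n : ℝ) * hbXi τ) ≤ (Ideal.absNorm P : ℝ) →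
      (Ideal.absNorm P : ℝ) < X ^ (1 - τ) → n < mBound τ := by
    intro n P hlo hhi
    have h1 : (n : ℝ) * hbXi τ < 1 - τ := exp_lt_of_rpow_le_of_lt hX hlo hhi
    have h2 : (n : ℝ) ≤ (3 / 2 - τ) / hbXi τ := by rw [le_div_iff₀ hξ]; linarith
    have h3 : n ≤ ⌊(3 / 2 - τ) / hbXi τ⌋₊ := Nat.le_floor h2
    rw [mBound]; omega
  have hnn : (n₁, n₂) ∈ nPairs τ := by
    unfold nPairs
    rw [mem_filter, mem_product, mem_range, mem_range]
    exact ⟨⟨hmB hlo1 hs1.2.2.2, hmB hlo2 hs2.2.2.2⟩, e2, e21, e1, esum⟩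
  refine hun (mem_image.mpr ⟨⟨(n₁, n₂), (P₁, t.2)⟩, mem_sigma.mpr ⟨hnn, mem_product.mpr ⟨hn₁, hn₂⟩⟩, ?_⟩)
  show ((({P₁} : Finset (Ideal (𝓞 K))), t.2) : Finset (Ideal (𝓞 K)) × Ideal (𝓞 K)) = t
  rw [← hP₁eq]

variable {ι : Type*} (E : Finset ι) (I : ι → Ideal (𝓞 K))

open scoped Classical in
/-- **The generic `U₂^{(1)}`-approximation inequality, raw form.** For any finite family of nonzero
ideals with `X³ < N(I_i) ≤ C_N X³` (`1 ≤ C_N < X^{3τ}`, `X > 1`, `0 < τ ≤ 1/40`,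
`1 ≤ μ ≤ τξ^{-1}`): `|U₂^{(1)} − Û₂^{(1)}|` is at most (T1) `#𝒵_{P₁P₂}` over the non-good indices
of `U^(1)`; (T2) twice `S_K(𝒵_{P₁P₂}, X^τ)` over the good indices in the four edge/close classes
(a member of norm `< X^{τ+ξ}` or `≥ X^{1−τ−ξ}`, the two norms within a factor `X^ξ`, or
`N(P₁P₂) < C_N X^{3/2+τ+2ξ}`); (T3) the weight error `((1+μ^{-1})^{N+1} − 1)·∑_{good} S_K(𝒵_{P₁P₂}, X^τ)`;
(T4) `72` times the four defect sums (close pairs `S_K(𝒵_{QP}, X^{1/2})`, equal-norm pairs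
`#𝒵_{QQ'}`, primes of degree `≥ 2` `#𝒵_Q`, squares `#𝒵_{Q²}`) — pp. 42–47 for `U₂^{(1)}`
("Here too we follow the same argument as used for `U^(n)`", p. 46), before any estimation.
[cite: HeathBrownActa2001, §7 pp. 46–47] -/
theorem U2_abs_sub_le (hX : 1 < X) (hτ : 0 < τ) (hτ1 : τ ≤ 1 / 40) (hCN1 : 1 ≤ CN)
    (hCN : CN < X ^ (3 * τ))
    (hE : ∀ i ∈ E, I i ≠ ⊥ ∧ X ^ 3 < (Ideal.absNorm (I i) : ℝ) ∧ (Ideal.absNorm (I i) : ℝ) ≤ CN * X ^ 3)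
    {μ : ℕ} (hμ : 1 ≤ μ) (hμle : (μ : ℝ) ≤ τ / hbXi τ) :
    |(U2one E I X τ : ℝ) - U2hat X τ E I| ≤
      ∑ t ∈ (Upairs X τ 1).filter (fun t => ¬ UGood t), (famCount E I (uIdeal t) : ℝ) +
      2 * ∑ t ∈ (Upairs X τ 1).filter (fun t => UGood t ∧
          X ^ (3 / 2 + τ) ≤ (Ideal.absNorm (uIdeal t) : ℝ) ∧
          ((∃ Q ∈ insert t.2 t.1, (Ideal.absNorm Q : ℝ) < X ^ (τ + hbXi τ)) ∨
           (∃ Q ∈ insert t.2 t.1, X ^ (1 - τ - hbXi τ) ≤ (Ideal.absNorm Q : ℝ)) ∨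
           (∃ Q ∈ insert t.2 t.1, ∃ Q' ∈ insert t.2 t.1, Ideal.absNorm Q < Ideal.absNorm Q' ∧
              (Ideal.absNorm Q' : ℝ) < Ideal.absNorm Q * X ^ hbXi τ) ∨
           ((Ideal.absNorm (uIdeal t) : ℝ) < CN * X ^ (3 / 2 + τ + 2 * hbXi τ)))),
        (famSifted E I (uIdeal t) (X ^ τ) : ℝ) +
      ((1 + 1 / (μ : ℝ)) ^ (u2Bound τ + 1) - 1) *
        ∑ t ∈ (Upairs X τ 1).filter (fun t => UGood t), (famSifted E I (uIdeal t) (X ^ τ) : ℝ) +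
      72 * (∑ x ∈ (primesNormIco (X ^ (1 / 2 : ℝ)) (X ^ (1 - τ)) ×ˢ
              primesNormIco (X ^ (1 / 2 : ℝ)) (X ^ (1 - τ))).filter
              (fun x => (Ideal.absNorm x.1).Prime ∧ (Ideal.absNorm x.2).Prime ∧
                Ideal.absNorm x.1 < Ideal.absNorm x.2 ∧
                (Ideal.absNorm x.2 : ℝ) < Ideal.absNorm x.1 * X ^ hbXi τ),
              (famSifted E I (x.1 * x.2) (X ^ (1 / 2 : ℝ)) : ℝ) +
            ∑ x ∈ (primesNormIco (X ^ (1 / 2 : ℝ)) (CN * X ^ 3 + 1) ×ˢ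
              primesNormIco (X ^ (1 / 2 : ℝ)) (CN * X ^ 3 + 1)).filter
              (fun x => x.1 ≠ x.2 ∧ Ideal.absNorm x.1 = Ideal.absNorm x.2),
              (famCount E I (x.1 * x.2) : ℝ) +
            ∑ Q ∈ (primesNormIco (X ^ (1 / 2 : ℝ)) (CN * X ^ 3 + 1)).filter
              (fun Q => ¬ (Ideal.absNorm Q).Prime), (famCount E I Q : ℝ) +
            ∑ Q ∈ (primesNormIco (X ^ (1 / 2 : ℝ)) (X ^ (1 - τ))).filter
              (fun Q => (Ideal.absNorm Q).Prime), (famCount E I (Q * Q) : ℝ)) := by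
  classical
  have hξ := hbXi_pos hτ
  have hX0 : 0 < X := by linarith
  have hτ8 : τ ≤ 1 / 8 := by linarith
  have h0 : ∀ i ∈ E, I i ≠ ⊥ := fun i hi => (hE i hi).1
  -- notation
  set Tex := (Upairs X τ 1).filter
    (fun t => X ^ (3 / 2 + τ) ≤ ((Ideal.absNorm (∏ P ∈ t.1, P) * Ideal.absNorm t.2 : ℕ) : ℝ)) with hTex
  set A := (nPairs τ).sigma (fun nn => Jprimes X τ nn.1 ×ˢ Jprimes X τ nn.2) with hA
  set φ : (Σ _nn : ℕ × ℕ, Ideal (𝓞 K) × Ideal (𝓞 K)) → Finset (Ideal (𝓞 K)) × Ideal (𝓞 K) :=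
    fun b => ((({b.2.1} : Finset (Ideal (𝓞 K))), b.2.2)) with hφ
  set F : Finset (Ideal (𝓞 K)) × Ideal (𝓞 K) → ℝ := fun t => (famSiftedAbove E I (uIdeal t) t.2 : ℝ) with hF
  set G : (Σ _nn : ℕ × ℕ, Ideal (𝓞 K) × Ideal (𝓞 K)) → ℝ := fun b =>
    ∑ y ∈ ((range (u2Bound τ + 1)).sigma (fun n => mIndexU2 τ n b.1.2)).sigma
        (fun x => Fintype.piFinset fun j => Jprimes X τ (x.2 j)),
      (∏ j, Real.log (Ideal.absNorm (y.2 j)) / ((y.1.2 j : ℝ) * hbXi τ * Real.log X)) *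
        #{i ∈ E | b.2.1 * b.2.2 * ∏ j, y.2 j = I i} with hG
  set CLASS : Finset (Ideal (𝓞 K)) × Ideal (𝓞 K) → Prop := fun t =>
    (∃ Q ∈ insert t.2 t.1, (Ideal.absNorm Q : ℝ) < X ^ (τ + hbXi τ)) ∨
    (∃ Q ∈ insert t.2 t.1, X ^ (1 - τ - hbXi τ) ≤ (Ideal.absNorm Q : ℝ)) ∨
    (∃ Q ∈ insert t.2 t.1, ∃ Q' ∈ insert t.2 t.1, Ideal.absNorm Q < Ideal.absNorm Q' ∧
      (Ideal.absNorm Q' : ℝ) < Ideal.absNorm Q * X ^ hbXi τ) ∨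
    ((Ideal.absNorm (uIdeal t) : ℝ) < CN * X ^ (3 / 2 + τ + 2 * hbXi τ)) with hCLASS
  set FEAT : ι → Prop := fun i =>
    (∃ A B : Ideal (𝓞 K), A.IsPrime ∧ A ≠ ⊥ ∧ B.IsPrime ∧ B ≠ ⊥ ∧
        (Ideal.absNorm A).Prime ∧ (Ideal.absNorm B).Prime ∧ A * B ∣ I i ∧
        X ^ (1 / 2 : ℝ) ≤ (Ideal.absNorm A : ℝ) ∧ Ideal.absNorm A < Ideal.absNorm B ∧
        (Ideal.absNorm B : ℝ) < Ideal.absNorm A * X ^ hbXi τ ∧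
        (Ideal.absNorm B : ℝ) < X ^ (1 - τ)) ∨
     (∃ A B : Ideal (𝓞 K), A.IsPrime ∧ A ≠ ⊥ ∧ B.IsPrime ∧ B ≠ ⊥ ∧ A ≠ B ∧
        Ideal.absNorm A = Ideal.absNorm B ∧ A * B ∣ I i ∧
        X ^ (1 / 2 : ℝ) ≤ (Ideal.absNorm A : ℝ)) ∨
     (∃ A : Ideal (𝓞 K), A.IsPrime ∧ A ≠ ⊥ ∧ ¬ (Ideal.absNorm A).Prime ∧ A ∣ I i ∧
        X ^ (1 / 2 : ℝ) ≤ (Ideal.absNorm A : ℝ)) ∨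
     (∃ A : Ideal (𝓞 K), A.IsPrime ∧ A ≠ ⊥ ∧ (Ideal.absNorm A).Prime ∧ A * A ∣ I i ∧
        X ^ (1 / 2 : ℝ) ≤ (Ideal.absNorm A : ℝ) ∧ (Ideal.absNorm A : ℝ) < X ^ (1 - τ)) with hFEAT
  set W : ℝ := (1 + 1 / (μ : ℝ)) ^ (u2Bound τ + 1) with hW
  set GOOD := (Upairs X τ 1).filter (fun t => UGood t) with hGOOD
  set GC := (Upairs X τ 1).filter (fun t => UGood t ∧
    X ^ (3 / 2 + τ) ≤ (Ideal.absNorm (uIdeal t) : ℝ) ∧ CLASS t) with hGC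
  set NG := (Upairs X τ 1).filter (fun t => ¬ UGood t) with hNG
  -- the two pieces as sums
  have hEx : (U2one E I X τ : ℝ) = ∑ t ∈ Tex, F t := by
    rw [U2one, UpieceWhere_eq, Nat.cast_sum]
  have hHat : U2hat X τ E I = ∑ b ∈ A, G b := U2hat_eq_sum E I hX hτ h0
  -- the hat indices: properties
  have hb_props : ∀ b ∈ A, b.1 ∈ nPairs τ ∧ b.2.1 ∈ Jprimes X τ b.1.1 ∧ b.2.2 ∈ Jprimes X τ b.1.2 := by
    intro b hb
    rw [hA, mem_sigma, mem_product] at hb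
    exact ⟨hb.1, hb.2.1, hb.2.2⟩
  have hφT : ∀ b ∈ A, φ b ∈ Tex := by
    intro b hb
    obtain ⟨h1, h2, h3⟩ := hb_props b hb
    exact (U2_index_props hX hτ hτ8 h1 h2 h3).2.2.2.2.2.2.2.2.2.2
  have hφU : ∀ b ∈ A, φ b ∈ Upairs X τ 1 := fun b hb => (mem_filter.mp (hφT b hb)).1
  have hφgood : ∀ b ∈ A, UGood (φ b) := by
    intro b hb
    obtain ⟨h1, h2, h3⟩ := hb_props b hb
    obtain ⟨⟨-, -, hpr1, -⟩, ⟨-, -, hpr2, -⟩, hN21, -⟩ := U2_index_props hX hτ hτ8 h1 h2 h3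
    exact UGood_pair hpr1 hpr2 hN21.ne
  have hinj : Set.InjOn φ A := by
    rintro ⟨nn, P₁, P₂⟩ hb ⟨nn', P₁', P₂'⟩ hb' h
    simp only [hφ, Prod.mk.injEq, singleton_inj] at h
    obtain ⟨rfl, rfl⟩ := h
    obtain ⟨-, h2, h3⟩ := hb_props _ hb
    obtain ⟨-, h2', h3'⟩ := hb_props _ hb'
    have e1 : nn.1 = nn'.1 := Jprimes_index_unique hX hτ h2 h2'
    have e2 : nn.2 = nn'.2 := Jprimes_index_unique hX hτ h3 h3'
    have : nn = nn' := Prod.ext e1 e2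
    subst this
    rfl
  have huφ : ∀ b : (Σ _nn : ℕ × ℕ, Ideal (𝓞 K) × Ideal (𝓞 K)), uIdeal (φ b) = b.2.1 * b.2.2 :=
    fun b => uIdeal_pair _ _
  -- split the exact sum into unmatched and matched parts
  have hsplit : ∑ t ∈ Tex, F t = ∑ t ∈ Tex.filter (fun t => t ∉ A.image φ), F t + ∑ b ∈ A, F (φ b) := by
    rw [← sum_filter_add_sum_filter_not Tex (fun t => t ∉ A.image φ)]
    congr 1
    have hset : Tex.filter (fun t => ¬ t ∉ A.image φ) = A.image φ := by
      ext t
      simp only [mem_filter, not_not, mem_image]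
      constructor
      · rintro ⟨-, h⟩; exact h
      · rintro ⟨b, hb, rfl⟩; exact ⟨hφT b hb, b, hb, rfl⟩
    rw [hset, sum_image hinj]
  -- nonnegativity facts
  have hF0 : ∀ t, 0 ≤ F t := fun t => Nat.cast_nonneg _
  -- (T1)+(T2): the unmatched part
  have hunm : ∑ t ∈ Tex.filter (fun t => t ∉ A.image φ), F t ≤
      ∑ t ∈ NG, (famCount E I (uIdeal t) : ℝ) + ∑ t ∈ GC, (famSifted E I (uIdeal t) (X ^ τ) : ℝ) := by
    have hpt : ∀ t ∈ Tex.filter (fun t => t ∉ A.image φ), F t ≤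
        (if ¬ UGood t then (famCount E I (uIdeal t) : ℝ) else 0) +
        (if UGood t ∧ X ^ (3 / 2 + τ) ≤ (Ideal.absNorm (uIdeal t) : ℝ) ∧ CLASS t then
          (famSifted E I (uIdeal t) (X ^ τ) : ℝ) else 0) := by
      intro t ht
      obtain ⟨htT, hun⟩ := mem_filter.mp ht
      obtain ⟨htU, hbig⟩ := mem_filter.mp htT
      have hbig' : X ^ (3 / 2 + τ) ≤ (Ideal.absNorm (uIdeal t) : ℝ) := by
        rw [absNorm_uIdeal]; exact hbig
      by_cases hg : UGood t
      · have hcl : CLASS t := U2_unmatched_cases hX hτ hCN1 htT hg hun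
        have h2 := (mem_smallPrimes_iff.mp (mem_Upairs_iff.mp htU).2.1).2.2.1
        rw [if_neg (not_not.mpr hg), if_pos ⟨hg, hbig', hcl⟩, zero_add]
        show (famSiftedAbove E I (uIdeal t) t.2 : ℝ) ≤ _
        exact_mod_cast famSiftedAbove_le_famSifted E I _ _ h2
      · rw [if_pos hg, if_neg (fun h => hg h.1), add_zero]
        show (famSiftedAbove E I (uIdeal t) t.2 : ℝ) ≤ _
        exact_mod_cast famSiftedAbove_le_famCount E I _ _
    calc ∑ t ∈ Tex.filter (fun t => t ∉ A.image φ), F t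
        ≤ ∑ t ∈ Tex.filter (fun t => t ∉ A.image φ),
            ((if ¬ UGood t then (famCount E I (uIdeal t) : ℝ) else 0) +
              (if UGood t ∧ X ^ (3 / 2 + τ) ≤ (Ideal.absNorm (uIdeal t) : ℝ) ∧ CLASS t then
                (famSifted E I (uIdeal t) (X ^ τ) : ℝ) else 0)) := sum_le_sum hpt
      _ = ∑ t ∈ (Tex.filter (fun t => t ∉ A.image φ)).filter (fun t => ¬ UGood t), (famCount E I (uIdeal t) : ℝ) +
          ∑ t ∈ (Tex.filter (fun t => t ∉ A.image φ)).filter (fun t => UGood t ∧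
              X ^ (3 / 2 + τ) ≤ (Ideal.absNorm (uIdeal t) : ℝ) ∧ CLASS t),
            (famSifted E I (uIdeal t) (X ^ τ) : ℝ) := by
          rw [sum_add_distrib, ← sum_filter, ← sum_filter]
      _ ≤ _ := by
          refine add_le_add ?_ ?_
          · refine sum_le_sum_of_subset_of_nonneg (fun t ht => ?_) fun _ _ _ => Nat.cast_nonneg _
            obtain ⟨ht1, ht2⟩ := mem_filter.mp ht
            exact mem_filter.mpr ⟨(mem_filter.mp (mem_filter.mp ht1).1).1, ht2⟩
          · refine sum_le_sum_of_subset_of_nonneg (fun t ht => ?_) fun _ _ _ => Nat.cast_nonneg _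
            obtain ⟨ht1, ht2⟩ := mem_filter.mp ht
            exact mem_filter.mpr ⟨(mem_filter.mp (mem_filter.mp ht1).1).1, ht2⟩
  -- the matched part, index by index
  have hper : ∀ b ∈ A, |F (φ b) - G b| ≤
      (if (Ideal.absNorm b.2.1 : ℝ) * Ideal.absNorm b.2.2 < CN * X ^ (3 / 2 + τ + 2 * hbXi τ) then
          (famSifted E I (b.2.1 * b.2.2) (X ^ τ) : ℝ) else 0) +
      2 * #{i ∈ E | b.2.1 * b.2.2 ∣ I i ∧ IsRough (X ^ (1 / 2 : ℝ)) (I i) ∧ FEAT i} +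
      (W - 1) * famSifted E I (b.2.1 * b.2.2) (X ^ τ) := by
    intro b hb
    obtain ⟨h1, h2, h3⟩ := hb_props b hb
    have h := U2_per_index_le E I hX hτ hτ8 hE hμ hμle h1 h2 h3 FEAT (fun i _ hi => hi)
    have hFb : F (φ b) = (famSiftedAbove E I (b.2.1 * b.2.2) b.2.2 : ℝ) := by
      simp only [hF]; rw [huφ]
    rw [hFb]
    simp only [hG, hW]
    convert h using 8
  -- sum of the window terms
  have hwin : ∑ b ∈ A, (if (Ideal.absNorm b.2.1 : ℝ) * Ideal.absNorm b.2.2 < CN * X ^ (3 / 2 + τ + 2 * hbXi τ) then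
      (famSifted E I (b.2.1 * b.2.2) (X ^ τ) : ℝ) else 0) ≤ ∑ t ∈ GC, (famSifted E I (uIdeal t) (X ^ τ) : ℝ) := by
    rw [← sum_filter]
    set Aw := A.filter (fun b => (Ideal.absNorm b.2.1 : ℝ) * Ideal.absNorm b.2.2 <
      CN * X ^ (3 / 2 + τ + 2 * hbXi τ)) with hAw
    have hinjw : Set.InjOn φ Aw := hinj.mono (fun b hb => (mem_filter.mp hb).1)
    have heq : ∑ b ∈ Aw, (famSifted E I (b.2.1 * b.2.2) (X ^ τ) : ℝ) =
        ∑ t ∈ Aw.image φ, (famSifted E I (uIdeal t) (X ^ τ) : ℝ) := by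
      rw [sum_image hinjw]
      exact sum_congr rfl fun b _ => by rw [huφ]
    rw [heq]
    refine sum_le_sum_of_subset_of_nonneg (fun t ht => ?_) fun _ _ _ => Nat.cast_nonneg _
    obtain ⟨b, hb, rfl⟩ := mem_image.mp ht
    obtain ⟨hbA, hbw⟩ := mem_filter.mp hb
    obtain ⟨h1, h2, h3⟩ := hb_props b hbA
    have hlo := (U2_index_props hX hτ hτ8 h1 h2 h3).2.2.2.2.2.2.2.2.1
    refine mem_filter.mpr ⟨hφU b hbA, hφgood b hbA, ?_, Or.inr (Or.inr (Or.inr ?_))⟩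
    · rw [huφ, map_mul, Nat.cast_mul]; exact hlo
    · rw [huφ, map_mul, Nat.cast_mul]; exact hbw
  -- sum of the feature terms
  have hfeat : ∑ b ∈ A, (2 * (#{i ∈ E | b.2.1 * b.2.2 ∣ I i ∧ IsRough (X ^ (1 / 2 : ℝ)) (I i) ∧ FEAT i} : ℝ)) ≤
      72 * (∑ x ∈ (primesNormIco (X ^ (1 / 2 : ℝ)) (X ^ (1 - τ)) ×ˢ
              primesNormIco (X ^ (1 / 2 : ℝ)) (X ^ (1 - τ))).filter
              (fun x => (Ideal.absNorm x.1).Prime ∧ (Ideal.absNorm x.2).Prime ∧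
                Ideal.absNorm x.1 < Ideal.absNorm x.2 ∧
                (Ideal.absNorm x.2 : ℝ) < Ideal.absNorm x.1 * X ^ hbXi τ),
              (famSifted E I (x.1 * x.2) (X ^ (1 / 2 : ℝ)) : ℝ) +
            ∑ x ∈ (primesNormIco (X ^ (1 / 2 : ℝ)) (CN * X ^ 3 + 1) ×ˢ
              primesNormIco (X ^ (1 / 2 : ℝ)) (CN * X ^ 3 + 1)).filter
              (fun x => x.1 ≠ x.2 ∧ Ideal.absNorm x.1 = Ideal.absNorm x.2),
              (famCount E I (x.1 * x.2) : ℝ) +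
            ∑ Q ∈ (primesNormIco (X ^ (1 / 2 : ℝ)) (CN * X ^ 3 + 1)).filter
              (fun Q => ¬ (Ideal.absNorm Q).Prime), (famCount E I Q : ℝ) +
            ∑ Q ∈ (primesNormIco (X ^ (1 / 2 : ℝ)) (X ^ (1 - τ))).filter
              (fun Q => (Ideal.absNorm Q).Prime), (famCount E I (Q * Q) : ℝ)) := by
    rw [← mul_sum]
    have h1 : ∑ b ∈ A, (#{i ∈ E | b.2.1 * b.2.2 ∣ I i ∧ IsRough (X ^ (1 / 2 : ℝ)) (I i) ∧ FEAT i} : ℝ) ≤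
        36 * #{i ∈ E | IsRough (X ^ (1 / 2 : ℝ)) (I i) ∧ FEAT i} := by
      convert U2_sum_card_le_mul E I hX hτ hτ1 hCN hE FEAT using 6
    have h2 := card_feat_le E I (X := X) (τ := τ) hE
    calc 2 * ∑ b ∈ A, (#{i ∈ E | b.2.1 * b.2.2 ∣ I i ∧ IsRough (X ^ (1 / 2 : ℝ)) (I i) ∧ FEAT i} : ℝ)
        ≤ 2 * (36 * #{i ∈ E | IsRough (X ^ (1 / 2 : ℝ)) (I i) ∧ FEAT i}) :=
          mul_le_mul_of_nonneg_left h1 (by norm_num)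
      _ = 72 * #{i ∈ E | IsRough (X ^ (1 / 2 : ℝ)) (I i) ∧ FEAT i} := by ring
      _ ≤ _ := mul_le_mul_of_nonneg_left h2 (by norm_num)
  -- sum of the weight terms
  have hW1 : 1 ≤ W := one_le_pow₀ (by
    have : (0 : ℝ) ≤ 1 / (μ : ℝ) := by positivity
    linarith)
  have hwt : ∑ b ∈ A, (W - 1) * (famSifted E I (b.2.1 * b.2.2) (X ^ τ) : ℝ) ≤
      (W - 1) * ∑ t ∈ GOOD, (famSifted E I (uIdeal t) (X ^ τ) : ℝ) := by
    rw [← mul_sum]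
    refine mul_le_mul_of_nonneg_left ?_ (by linarith)
    have heq : ∑ b ∈ A, (famSifted E I (b.2.1 * b.2.2) (X ^ τ) : ℝ) =
        ∑ t ∈ A.image φ, (famSifted E I (uIdeal t) (X ^ τ) : ℝ) := by
      rw [sum_image hinj]
      exact sum_congr rfl fun b _ => by rw [huφ]
    rw [heq]
    refine sum_le_sum_of_subset_of_nonneg (fun t ht => ?_) fun _ _ _ => Nat.cast_nonneg _
    obtain ⟨b, hb, rfl⟩ := mem_image.mp ht
    exact mem_filter.mpr ⟨hφU b hb, hφgood b hb⟩
  -- assemble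
  have hmatched : |∑ b ∈ A, (F (φ b) - G b)| ≤
      ∑ t ∈ GC, (famSifted E I (uIdeal t) (X ^ τ) : ℝ) +
      72 * (∑ x ∈ (primesNormIco (X ^ (1 / 2 : ℝ)) (X ^ (1 - τ)) ×ˢ
              primesNormIco (X ^ (1 / 2 : ℝ)) (X ^ (1 - τ))).filter
              (fun x => (Ideal.absNorm x.1).Prime ∧ (Ideal.absNorm x.2).Prime ∧
                Ideal.absNorm x.1 < Ideal.absNorm x.2 ∧
                (Ideal.absNorm x.2 : ℝ) < Ideal.absNorm x.1 * X ^ hbXi τ),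
              (famSifted E I (x.1 * x.2) (X ^ (1 / 2 : ℝ)) : ℝ) +
            ∑ x ∈ (primesNormIco (X ^ (1 / 2 : ℝ)) (CN * X ^ 3 + 1) ×ˢ
              primesNormIco (X ^ (1 / 2 : ℝ)) (CN * X ^ 3 + 1)).filter
              (fun x => x.1 ≠ x.2 ∧ Ideal.absNorm x.1 = Ideal.absNorm x.2),
              (famCount E I (x.1 * x.2) : ℝ) +
            ∑ Q ∈ (primesNormIco (X ^ (1 / 2 : ℝ)) (CN * X ^ 3 + 1)).filter
              (fun Q => ¬ (Ideal.absNorm Q).Prime), (famCount E I Q : ℝ) +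
            ∑ Q ∈ (primesNormIco (X ^ (1 / 2 : ℝ)) (X ^ (1 - τ))).filter
              (fun Q => (Ideal.absNorm Q).Prime), (famCount E I (Q * Q) : ℝ)) +
      (W - 1) * ∑ t ∈ GOOD, (famSifted E I (uIdeal t) (X ^ τ) : ℝ) := by
    calc |∑ b ∈ A, (F (φ b) - G b)| ≤ ∑ b ∈ A, |F (φ b) - G b| := abs_sum_le_sum_abs _ _
      _ ≤ ∑ b ∈ A, ((if (Ideal.absNorm b.2.1 : ℝ) * Ideal.absNorm b.2.2 < CN * X ^ (3 / 2 + τ + 2 * hbXi τ) then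
            (famSifted E I (b.2.1 * b.2.2) (X ^ τ) : ℝ) else 0) +
          2 * #{i ∈ E | b.2.1 * b.2.2 ∣ I i ∧ IsRough (X ^ (1 / 2 : ℝ)) (I i) ∧ FEAT i} +
          (W - 1) * famSifted E I (b.2.1 * b.2.2) (X ^ τ)) := sum_le_sum hper
      _ = _ + _ + _ := by rw [sum_add_distrib, sum_add_distrib]
      _ ≤ _ := add_le_add (add_le_add hwin hfeat) hwt
  have hunm0 : 0 ≤ ∑ t ∈ Tex.filter (fun t => t ∉ A.image φ), F t := sum_nonneg fun t _ => hF0 t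
  rw [hEx, hHat, hsplit]
  have e : ∑ t ∈ Tex.filter (fun t => t ∉ A.image φ), F t + ∑ b ∈ A, F (φ b) - ∑ b ∈ A, G b =
      ∑ t ∈ Tex.filter (fun t => t ∉ A.image φ), F t + ∑ b ∈ A, (F (φ b) - G b) := by
    rw [sum_sub_distrib]; ring
  rw [e]
  calc |∑ t ∈ Tex.filter (fun t => t ∉ A.image φ), F t + ∑ b ∈ A, (F (φ b) - G b)|
      ≤ |∑ t ∈ Tex.filter (fun t => t ∉ A.image φ), F t| + |∑ b ∈ A, (F (φ b) - G b)| := abs_add_le _ _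
    _ = ∑ t ∈ Tex.filter (fun t => t ∉ A.image φ), F t + |∑ b ∈ A, (F (φ b) - G b)| := by
        rw [abs_of_nonneg hunm0]
    _ ≤ _ := by linarith [hunm, hmatched]

end Generic


end Literature.NumberTheory.Sieve.CubicSieve

end
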